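import Mathlib
import HarnessLib
import HarnessLib.Audit
import Summits.MatrixMultiplication.Statement
import Literature.Computability.AlgebraicComplexity.FlatteningBound
import Literature.Computability.AlgebraicComplexity.AsymptoticSpectrum
import Literature.Computability.AlgebraicComplexity.QuantumFunctionals
import Literature.Computability.AlgebraicComplexity.BIPNoOccurrenceProofs
import HarnessLib.Audit.Status.Attr

/-!
Route: ObstructionDescent

# Route ObstructionDescent — omega=2 iff no occurrence obstruction survives above the quadratic
scale, occurrence lifts to multiplicity, and multiplicity obstructions decide

It suffices to show X = NoOccurrenceObstruction ∧ OccurrenceLifts ∧ MultiplicityDecides (P_O ∧ L ∧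
D), and S ⟺ X in kernel (lens file
`summit_iff`, HOME/decomp-mm-lens-3/ObstructionDescent.lean, 0 sorry). The ONE certified translation
is E2: ω(ℂ) = 2 ⟺ REQ := «∀ τ > 2,
R(⟨n,n,n⟩) ≤ n^τ for all large n» (kernel both ways, `rankEventuallyQuadratic_iff`); beneath it the
Bürgisser–Ikenmeyer dictionary
(R̲(t) ≤ m ⟺ t ∈ closure(GL_m³·⟨m⟩); types Λ of weight vectors in the graded coordinate rings;
occurrence and multiplicity obstructions)
cuts REQ into: P_O «no occurrence obstruction against R̲(⟨n,n,n⟩) ≤ n^{2+ε}» (every type occurring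
for pad_m⟨n,n,n⟩ occurs for ⟨m⟩,
m ≥ n^τ), L «occurrence-freeness lifts to multiplicity-freeness for this pair» (P_O → P_M), D
«multiplicity-freeness decides»
(P_M → REQ, the GCT completeness credo restricted to matrix multiplication versus unit tensors;
DECLARED RESIDUAL). Every piece is a
NECESSARY consequence of S (kernel: S ⟹ REQ ⟹ P_M ⟹ P_O). Decomposition-workshop node (decomp-mm
lens 3 «one certified translation + split beneath»; drafted gen 3, filed lens-born gen 6 once the
cell's freeze on new splits was lifted by three landings); no idea card realised. Registered first
line under P_O (birth skeleton, kernel `noOccurrenceObstruction_of`): P_O ⟸ UnitSaturation «few-row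
occurrence saturation of closure(GL_m³·⟨m⟩) at polynomial padding m ≥ k^{1+ε}» (pure unit-tensor
GCT, no matrix multiplication in it; template BIP19/IP17) ∧ PadInheritance «weight vectors of a type
with more than n² parts in some factor vanish on GL_m³·pad_m⟨n,n,n⟩» (inheritance; provable now).
Lean: `(∀ τ : ℝ, 2 < τ → ∃ n₀ : ℕ, ∀ n m : ℕ, n₀ ≤ n → ∀ h : n * n ≤ m, (n : ℝ) ^ τ ≤ (m : ℝ) → ∀ (Λ
: Fin 3 → Fin m → ℕ) (d : ℕ) (W : Set (MvPolynomial (Fin m × Fin m × Fin m) ℂ)), W = {f |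
f.IsHomogeneous d ∧ ∀ A B C : Matrix (Fin m) (Fin m) ℂ, ((∀ i j : Fin m, j < i → A i j = 0) ∧ ∀ i :
Fin m, A i i ≠ 0) → ((∀ i j : Fin m, j < i → B i j = 0) ∧ ∀ i : Fin m, B i i ≠ 0) → ((∀ i j : Fin m,
j < i → C i j = 0) ∧ ∀ i : Fin m, C i i ≠ 0) → ∀ t : Fin m → Fin m → Fin m → ℂ, MvPolynomial.aeval
(fun p : Fin m × Fin m × Fin m => Literature.Computability.AlgebraicComplexity.actTensor A B C t p.1
p.2.1 p.2.2) f = (∏ i, A i i ^ Λ 0 i) * (∏ i, B i i ^ Λ 1 i) * (∏ i, C i i ^ Λ 2 i) *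
MvPolynomial.aeval (fun p : Fin m × Fin m × Fin m => t p.1 p.2.1 p.2.2) f} → (∀ f ∈ W, ∀ A B C :
Matrix (Fin m) (Fin m) ℂ, A.det ≠ 0 → B.det ≠ 0 → C.det ≠ 0 → MvPolynomial.aeval (fun p : Fin m ×
Fin m × Fin m => Literature.Computability.AlgebraicComplexity.actTensor A B C
(Literature.Computability.AlgebraicComplexity.unitTensor ℂ m) p.1 p.2.1 p.2.2) f = 0) → ∀ f ∈ W, ∀ A
B C : Matrix (Fin m) (Fin m) ℂ, A.det ≠ 0 → B.det ≠ 0 → C.det ≠ 0 → MvPolynomial.aeval (fun p : Fin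
m × Fin m × Fin m => Literature.Computability.AlgebraicComplexity.actTensor A B C ((fun a b c : Fin
m => ∑ r : (Fin n × Fin n) × (Fin n × Fin n) × (Fin n × Fin n), (if Fin.castLE h (finProdFinEquiv
r.1) = a ∧ Fin.castLE h (finProdFinEquiv r.2.1) = b ∧ Fin.castLE h (finProdFinEquiv r.2.2) = c then
(1 : ℂ) else 0) * Literature.Computability.AlgebraicComplexity.matMulTensor ℂ n n n r.1 r.2.1
r.2.2)) p.1 p.2.1 p.2.2) f = 0) ∧ ((∀ τ : ℝ, 2 < τ → ∃ n₀ : ℕ, ∀ n m : ℕ, n₀ ≤ n → ∀ h : n * n ≤ m,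
(n : ℝ) ^ τ ≤ (m : ℝ) → ∀ (Λ : Fin 3 → Fin m → ℕ) (d : ℕ) (W : Set (MvPolynomial (Fin m × Fin m ×
Fin m) ℂ)), W = {f | f.IsHomogeneous d ∧ ∀ A B C : Matrix (Fin m) (Fin m) ℂ, ((∀ i j : Fin m, j < i
→ A i j = 0) ∧ ∀ i : Fin m, A i i ≠ 0) → ((∀ i j : Fin m, j < i → B i j = 0) ∧ ∀ i : Fin m, B i i ≠
0) → ((∀ i j : Fin m, j < i → C i j = 0) ∧ ∀ i : Fin m, C i i ≠ 0) → ∀ t : Fin m → Fin m → Fin m →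
ℂ, MvPolynomial.aeval (fun p : Fin m × Fin m × Fin m =>
Literature.Computability.AlgebraicComplexity.actTensor A B C t p.1 p.2.1 p.2.2) f = (∏ i, A i i ^ Λ
0 i) * (∏ i, B i i ^ Λ 1 i) * (∏ i, C i i ^ Λ 2 i) * MvPolynomial.aeval (fun p : Fin m × Fin m × Fin
m => t p.1 p.2.1 p.2.2) f} → (∀ f ∈ W, ∀ A B C : Matrix (Fin m) (Fin m) ℂ, A.det ≠ 0 → B.det ≠ 0 →
C.det ≠ 0 → MvPolynomial.aeval (fun p : Fin m × Fin m × Fin m =>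
Literature.Computability.AlgebraicComplexity.actTensor A B C
(Literature.Computability.AlgebraicComplexity.unitTensor ℂ m) p.1 p.2.1 p.2.2) f = 0) → ∀ f ∈ W, ∀ A
B C : Matrix (Fin m) (Fin m) ℂ, A.det ≠ 0 → B.det ≠ 0 → C.det ≠ 0 → MvPolynomial.aeval (fun p : Fin
m × Fin m × Fin m => Literature.Computability.AlgebraicComplexity.actTensor A B C ((fun a b c : Fin
m => ∑ r : (Fin n × Fin n) × (Fin n × Fin n) × (Fin n × Fin n), (if Fin.castLE h (finProdFinEquiv
r.1) = a ∧ Fin.castLE h (finProdFinEquiv r.2.1) = b ∧ Fin.castLE h (finProdFinEquiv r.2.2) = c then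
(1 : ℂ) else 0) * Literature.Computability.AlgebraicComplexity.matMulTensor ℂ n n n r.1 r.2.1
r.2.2)) p.1 p.2.1 p.2.2) f = 0) → (∀ τ : ℝ, 2 < τ → ∃ n₀ : ℕ, ∀ n m : ℕ, n₀ ≤ n → ∀ h : n * n ≤ m,
(n : ℝ) ^ τ ≤ (m : ℝ) → ∀ (Λ : Fin 3 → Fin m → ℕ) (d : ℕ) (W : Set (MvPolynomial (Fin m × Fin m ×
Fin m) ℂ)), W = {f | f.IsHomogeneous d ∧ ∀ A B C : Matrix (Fin m) (Fin m) ℂ, ((∀ i j : Fin m, j < i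
→ A i j = 0) ∧ ∀ i : Fin m, A i i ≠ 0) → ((∀ i j : Fin m, j < i → B i j = 0) ∧ ∀ i : Fin m, B i i ≠
0) → ((∀ i j : Fin m, j < i → C i j = 0) ∧ ∀ i : Fin m, C i i ≠ 0) → ∀ t : Fin m → Fin m → Fin m →
ℂ, MvPolynomial.aeval (fun p : Fin m × Fin m × Fin m =>
Literature.Computability.AlgebraicComplexity.actTensor A B C t p.1 p.2.1 p.2.2) f = (∏ i, A i i ^ Λ
0 i) * (∏ i, B i i ^ Λ 1 i) * (∏ i, C i i ^ Λ 2 i) * MvPolynomial.aeval (fun p : Fin m × Fin m × Fin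
m => t p.1 p.2.1 p.2.2) f} → Module.finrank ℂ ↥(Submodule.span ℂ (W ∩ {f | ∀ A B C : Matrix (Fin m)
(Fin m) ℂ, A.det ≠ 0 → B.det ≠ 0 → C.det ≠ 0 → MvPolynomial.aeval (fun p : Fin m × Fin m × Fin m =>
Literature.Computability.AlgebraicComplexity.actTensor A B C
(Literature.Computability.AlgebraicComplexity.unitTensor ℂ m) p.1 p.2.1 p.2.2) f = 0})) ≤
Module.finrank ℂ ↥(Submodule.span ℂ (W ∩ {f | ∀ A B C : Matrix (Fin m) (Fin m) ℂ, A.det ≠ 0 → B.det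
≠ 0 → C.det ≠ 0 → MvPolynomial.aeval (fun p : Fin m × Fin m × Fin m =>
Literature.Computability.AlgebraicComplexity.actTensor A B C ((fun a b c : Fin m => ∑ r : (Fin n ×
Fin n) × (Fin n × Fin n) × (Fin n × Fin n), (if Fin.castLE h (finProdFinEquiv r.1) = a ∧ Fin.castLE
h (finProdFinEquiv r.2.1) = b ∧ Fin.castLE h (finProdFinEquiv r.2.2) = c then (1 : ℂ) else 0) *
Literature.Computability.AlgebraicComplexity.matMulTensor ℂ n n n r.1 r.2.1 r.2.2)) p.1 p.2.1 p.2.2)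
f = 0})))) ∧ ((∀ τ : ℝ, 2 < τ → ∃ n₀ : ℕ, ∀ n m : ℕ, n₀ ≤ n → ∀ h : n * n ≤ m, (n : ℝ) ^ τ ≤ (m : ℝ)
→ ∀ (Λ : Fin 3 → Fin m → ℕ) (d : ℕ) (W : Set (MvPolynomial (Fin m × Fin m × Fin m) ℂ)), W = {f |
f.IsHomogeneous d ∧ ∀ A B C : Matrix (Fin m) (Fin m) ℂ, ((∀ i j : Fin m, j < i → A i j = 0) ∧ ∀ i :
Fin m, A i i ≠ 0) → ((∀ i j : Fin m, j < i → B i j = 0) ∧ ∀ i : Fin m, B i i ≠ 0) → ((∀ i j : Fin m,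
j < i → C i j = 0) ∧ ∀ i : Fin m, C i i ≠ 0) → ∀ t : Fin m → Fin m → Fin m → ℂ, MvPolynomial.aeval
(fun p : Fin m × Fin m × Fin m => Literature.Computability.AlgebraicComplexity.actTensor A B C t p.1
p.2.1 p.2.2) f = (∏ i, A i i ^ Λ 0 i) * (∏ i, B i i ^ Λ 1 i) * (∏ i, C i i ^ Λ 2 i) *
MvPolynomial.aeval (fun p : Fin m × Fin m × Fin m => t p.1 p.2.1 p.2.2) f} → Module.finrank ℂ
↥(Submodule.span ℂ (W ∩ {f | ∀ A B C : Matrix (Fin m) (Fin m) ℂ, A.det ≠ 0 → B.det ≠ 0 → C.det ≠ 0 →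
MvPolynomial.aeval (fun p : Fin m × Fin m × Fin m =>
Literature.Computability.AlgebraicComplexity.actTensor A B C
(Literature.Computability.AlgebraicComplexity.unitTensor ℂ m) p.1 p.2.1 p.2.2) f = 0})) ≤
Module.finrank ℂ ↥(Submodule.span ℂ (W ∩ {f | ∀ A B C : Matrix (Fin m) (Fin m) ℂ, A.det ≠ 0 → B.det
≠ 0 → C.det ≠ 0 → MvPolynomial.aeval (fun p : Fin m × Fin m × Fin m =>
Literature.Computability.AlgebraicComplexity.actTensor A B C ((fun a b c : Fin m => ∑ r : (Fin n ×
Fin n) × (Fin n × Fin n) × (Fin n × Fin n), (if Fin.castLE h (finProdFinEquiv r.1) = a ∧ Fin.castLE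
h (finProdFinEquiv r.2.1) = b ∧ Fin.castLE h (finProdFinEquiv r.2.2) = c then (1 : ℂ) else 0) *
Literature.Computability.AlgebraicComplexity.matMulTensor ℂ n n n r.1 r.2.1 r.2.2)) p.1 p.2.1 p.2.2)
f = 0}))) → (∀ τ : ℝ, 2 < τ → ∃ n₀ : ℕ, ∀ n : ℕ, n₀ ≤ n →
(Literature.Computability.AlgebraicComplexity.tensorRank
(Literature.Computability.AlgebraicComplexity.matMulTensor ℂ n n n) : ℝ) ≤ (n : ℝ) ^ τ))`

## Assembly
`closes (h₁ : NoOccurrenceObstruction) (h₂ : OccurrenceLifts) (h₃ : MultiplicityDecides) :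
_root_.MatrixMultiplication` (glue.lean, 12
lines): h₃ (h₂ h₁) is the rank form REQ; ω ≥ 2 is the kernel floor `omega_two_le ℂ`; ω ≤ 2 by
`le_of_forall_pos_le_add`: for ε > 0, REQ at
τ = 2 + ε makes 2 + ε an admissible exponent (`IsBigO.of_bound 1`), so ω = sInf ≤ 2 + ε (`csInf_le`,
`admissibleExponents_bddBelow`). All
three cruxes are consumed (bc6: declared 5 / in-cone 3 / aside 2); exactness S ⟺ P_O ∧ L ∧ D is the
lens file's `summit_iff`.

Rationale: WHY THIS LINE. Geometric complexity theory (BurgisserIkenmeyer2011, BurgisserIkenmeyer2013,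
BurgisserIkenmeyerPanova2019, DorflerIkenmeyerPanova2020,
IkenmeyerKandasamy2020) is used in the tree only on the LOWER-BOUND side (Literature
`MatMulOccurrenceObstructions*`,
`UnitTensorSLObstructions*`; Theses BorderRankLowerBound, SuccinctSecantEquations) or as a
STRONGER-than-S hypothesis (Theses
IsotypicSaturation, SchurWeylEquivariant); no route and no cell node types its UPPER-BOUND side: ω =
2 holds iff every
representation-theoretic obstruction against ⟨n,n,n⟩ ∈ closure(GL³·⟨n^{2+ε}⟩) vanishes AND the
obstructions are complete. The import
is invariant theory / representation theory of GL_m³ (weight vectors under the Borel, graded pieces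
of orbit-closure ideals), with the
explicit dictionary of BI11 §3; the vanishing halves (P_O, P_M) are exactly the statements whose
analogues are THEOREMS where GCT has
been tested — no occurrence obstructions for det vs padded per (BIP19, tree
`bip_no_occurrence_obstruction_succ`), occurrence-free
yet multiplicity-obstructed Chow vs power sums (DIP20 Thm 2.3(2), tree theorem
`DIP20_thm_2_3_2a_holds`), no G_s-obstructions for unit
tensors (BI11 Thm 4.6, tree named fact `burgisserIkenmeyer2011_thm_4_6`), and the one printed
GL-occurrence obstruction against matrix
multiplication beyond the trivial scale refuted in the tree (`not_burgisserIkenmeyer2013_rem_4_7`).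
What it does that no route does: it
makes «are there occurrence / multiplicity obstructions against ω = 2?» two typed, necessary,
strictly-weaker targets with finite
instruments (T_O1–T_O3) and isolates the completeness credo as the declared residual.

RANKED CRUXES. #2 NoOccurrenceObstruction (crux) — P_O «no occurrence obstruction above the
quadratic scale»: for every τ > 2 there is n₀ such that for all n ≥ n₀ and all m with n² ≤ m and n^τ
≤ m, for every type Λ ∈ (ℕ^m)³ and degree d, writing W for the set of weight vectors of type Λ and
degree d (homogeneous degree-d polynomial functions on ℂ^m ⊗ ℂ^m ⊗ ℂ^m that are B_m³-semi-invariant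
with character Λ under the substitution action of upper-triangular matrices): if every f ∈ W
vanishes on the orbit GL_m³·⟨m⟩ of the unit tensor then every f ∈ W vanishes on GL_m³·pad_m⟨n,n,n⟩ —
every type occurring for pad_m⟨n,n,n⟩ occurs for ⟨m⟩ (BI11 §3.1: S(pad_m⟨n,n,n⟩) ⊆ S(⟨m⟩) in each
degree). Tag WEAKER (S ⟹ P_O kernel `noOccurrenceObstruction_of_summit`; P_O ⟹ S open and
false-by-analogy: DIP20, BIP19, BI11 Thm 4.6); leaf UNDECIDED-in-print → INSTRUMENTABLE (T_O1, T_O3)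
+ IDEA-NEEDED (BIP19-style «all relevant types occur for closure(GL³⟨m⟩)» via BI11 Thm 5.x).
[difficulty: open-problem] (why it might fail: false iff some GL_m³-type occurs for pad_m⟨n,n,n⟩ but
not for ⟨m⟩ with m ≥ n^{2+ε} for infinitely many n — an occurrence obstruction proving ω > 2; none
is known at any super-n² scale (BI11 Lemma 6.1 reaches n²+O(1); BI13's λ(κ) is refuted in the
tree).) [BurgisserIkenmeyer2011, BurgisserIkenmeyer2013, DorflerIkenmeyerPanova2020,
arXiv:2503.22633]
#3 OccurrenceLifts (crux) — L «occurrence lifts to multiplicity»: NoOccurrenceObstruction →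
NoMultiplicityObstruction, i.e. if no occurrence obstruction survives above the quadratic scale
then, at the same scale and type by type, dim(W ∩ I(GL_m³·⟨m⟩)) ≤ dim(W ∩ I(GL_m³·pad_m⟨n,n,n⟩))
(equivalently mult_Λ ℂ[closure(GL³ pad)]_d ≤ mult_Λ ℂ[closure(GL³⟨m⟩)]_d). Tag UNDECIDED-with-test
(S ⟹ L kernel `occurrenceLifts_of_summit`; L fails exactly in the world P_O ∧ ¬P_M, which DIP20 Thm
2.3(2) realises in the Chow/power-sum model); leaf INSTRUMENTABLE (T_O1: at (n,m) = (2,6), where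
R̲(⟨2,2,2⟩) = 7, is non-membership witnessed by occurrence, by multiplicity only, or by neither up
to degree 20). [deps: NoOccurrenceObstruction] [difficulty: open-problem] (why it might fail: false
iff matrix multiplication vs unit tensors is «occurrence-complete but multiplicity-incomplete» above
n^{2+ε} — the DIP20 phenomenon (multiplicity obstructions strictly stronger) transplanted to this
pair; T_O1 is its first finite test.) [DorflerIkenmeyerPanova2020, BurgisserIkenmeyer2011,
HauensteinIkenmeyerLandsberg2013]
#4 MultiplicityDecides (crux) — D «multiplicity obstructions decide» (DECLARED RESIDUAL):
NoMultiplicityObstruction → RankEventuallyQuadratic, i.e. if for every τ > 2, all large n and all m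
≥ n^τ the multiplicities of closure(GL_m³·pad_m⟨n,n,n⟩) are dominated type by type by those of
closure(GL_m³·⟨m⟩), then R(⟨n,n,n⟩) ≤ n^{2+o(1)} — completeness of the representation-theoretic
obstructions for this pair of orbit closures (the GCT credo, Mulmuley–Sohoni / BI11 §1). Tag
RESIDUAL · IDEA-NEEDED (S ⟹ D kernel `multiplicityDecides_of_summit`; D holds in every ¬P_M world).
[deps: OccurrenceLifts] [difficulty: open-problem] (why it might fail: false iff ω > 2 while no
multiplicity obstruction detects it (orbit-closure non-containment invisible to graded
multiplicities at scale n^{2+ε}) — possible in principle since multiplicity domination does not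
imply containment of orbit closures in general.) [BurgisserIkenmeyer2011,
BurgisserIkenmeyerPanova2019, arXiv:2411.03444]
#9 RankEventuallyQuadratic (support) — E2, the rank form of ω(ℂ) = 2 (the ONE equivalence layer;
aside, never staffed): for every τ > 2, R(⟨n,n,n⟩) ≤ n^τ for all large n. Kernel:
`rankEventuallyQuadratic_iff : RankEventuallyQuadratic ↔ MatrixMultiplication`. [difficulty:
provable-now] [Blaser2013]
#9 NoMultiplicityObstruction (support) — P_M «no multiplicity obstruction above the quadratic scale»
(aside, intermediate node; target of L, hypothesis of D): same scale as P_O with occurrence replaced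
by type-wise domination of co-multiplicities dim(W ∩ I(GL_m³·⟨m⟩)) ≤ dim(W ∩ I(GL_m³·pad_m⟨n,n,n⟩)).
NEC kernel (`noMultiplicityObstruction_of_summit`); `closes_mult : P_M → D → S`. [difficulty:
open-problem] [BurgisserIkenmeyer2011, DorflerIkenmeyerPanova2020]

TWO-LAYER PLAN. NoOccurrenceObstruction ⇐ OrbitSemigroupSaturation → ClosureGapControl →
NoOccurrenceObstruction (foreseen, NOT filed): BI11 Thm 5.x
describes the semigroup of types of the ORBIT GL_m³·⟨m⟩ (Kronecker coefficients and stabiliser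
invariants); a BIP19-style proof of P_O
would show (i) every type with Kronecker-positive normalisation and ≤ m parts occurs for the orbit
closure of ⟨m⟩ after bounded
stretching (the tree's `IsotypicOccurrenceSemigroup` gives the semigroup property) and (ii) the
types of pad_m⟨n,n,n⟩ in degree d have
≤ n² «active» parts, so for m ≥ n^τ they fall in the saturated region. OccurrenceLifts is not split
before T_O1 reports.

KILL CRITERIA. A refutation of NoOccurrenceObstruction or of NoMultiplicityObstruction is a
representation-theoretic proof of ω > 2 and refutes the
SUMMIT (each is necessary in kernel) — it closes everything. A refutation of OccurrenceLifts (an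
instance family «occurrence-free but
multiplicity-obstructed» for ⟨n,n,n⟩ vs ⟨n^{2+ε}⟩) also refutes S (S ⟹ L). A refutation of
MultiplicityDecides (¬P_M… no: D false means
P_M ∧ ¬REQ, i.e. ω > 2 with no multiplicity obstruction) refutes S as well. So no piece can be
refuted without refuting ω = 2: the route
is killed only by (a) a proof of ω > 2, or (b) the critic/tribunal verdict that P_O is not
attackable (no instrument moves in two cycles),
in which case it is shelved as certified, or (c) a proof of ω = 2 elsewhere (moot).

NOT DECOMPOSED YET. P_O is not split at open (the foreseen split above waits for T_O1/T_O3); the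
duality relabelling of types (contragredient convention of
`hwvSpace`), the passage rank ↔ border rank (absorbed by τ > 2, so Bini is never needed), the
Zariski = Euclidean closure of orbits
(never needed: all statements are on the ideal side), and the Schur–Weyl reading of occurrence (the
tree's `isotypicSum₁₂₃ … kroneckerPow`
language, equivalent in print to the weight-vector language used here) are deliberately left as
theorem-level remarks.

CHEAPEST FALSIFIER. T_O1 (finite linear algebra over ℚ, estimated < 20 core-h, census seat): list
the types Λ of degree d ≤ 20 in format m = 6 whose weight
vectors all vanish on σ_6 = closure(GL_6³·⟨6⟩) but not all on GL_6³·pad_6⟨2,2,2⟩ (an OCCURRENCE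
witness of R̲(⟨2,2,2⟩) = 7 > 6), and
compare co-multiplicities. Outcome «occurrence witness exists» supports L's world;
«multiplicity-only» is the DIP20 phenomenon at the
matrix-multiplication pair (evidence against L as a theorem-schema, for P_O); «neither up to degree
20» says HIL13's equations are not
weight vectors of a non-occurring type — each outcome re-prices a piece. Lookup already done: the
only printed GL-occurrence obstruction
against ⟨m,m,m⟩ beyond the trivial scale (BI13 Rem 4.7) is refuted in the tree.

NUMBERS. ω ≤ 2.37295 in kernel (`LeGall2014_cw4_omega_le`; print 2.371339); kernel rungs of P_M: τ >
ω, τ > 2.37295, cubic format m ≥ n³;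
R̲(⟨2,2,2⟩) = 7 (Landsberg 2006, HIL13); best obstruction-certified border-rank bounds for ⟨n,n,n⟩:
SL-occurrence n²+O(1) (BI11 Lemma 6.1,
tree `burgisserIkenmeyer2011_lemma_6_1_holds`), GL-occurrence (3n²−3)/2 claimed (BI13) — refuted in
tree; Δ(⟨m⟩) = Kron(m,m,m) for m ≤ 4
(tree `vandenBergEtAl2025_unitTensor_four_polytope_maximal_holds`), open m ≥ 5 (arXiv:2503.22633).

DEFINITION REQUESTS. None filed: the items are inlined over
`Literature.Computability.AlgebraicComplexity.{actTensor, unitTensor, matMulTensor, tensorRank}`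
and Mathlib (`MvPolynomial.aeval`, `MvPolynomial.IsHomogeneous`, `Submodule.span`, `Module.finrank`,
`Fin.castLE`, `finProdFinEquiv`);
the structured calculus
(Idx/Tensor/fromCols/padTensor/padMM/evalT/orbitVanishing/borel/weightChar/hwvSpace/coMult +
soundness lemmas,
Part 1 of the lens file, 0 sorry) is offered as `Theorems/ObstructionCalculus.lean` with the
transports `noOccurrenceObstruction_iff` /
`noMultiplicityObstruction_iff` — to be proposed `--supports` the P_O item after birth (not before:
orphan rule).

BIRTH CERTIFICATE (gen 6, planner side; raw outputs in the seat folder NOTES.md). bc1 cone = 3/3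
load-bearing binders of `closes`
(NoOccurrenceObstruction, OccurrenceLifts, MultiplicityDecides; native check). bc2 no crux implies S
cheaply (tribunal kernel t1 clean
for all three; each crux is a NECESSARY consequence of S in kernel, converse open); S → C recorded
(all three are consequences of S and all
three are consumed by `closes`). bc3 skeleton for the deciding crux P_O: `noOccurrenceObstruction_of
: UnitSaturation → PadInheritance →
NoOccurrenceObstruction` (kernel, sorries only in the two stubs; registered as
Cruxes/NoOccurrenceObstruction/Lines/birth.lean after
birth); OccurrenceLifts: same few-parts/many-parts device (stub_fewPartsLift, stub_manyPartsCoMult),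
plan-only; MultiplicityDecides:
declared residual, no line. bc4 dedup: no tree theorem or item of these shapes (searches in NOVELTY;
negatives index clean). bc5 witness of
weakness for P_O, three forms: (a) SIBLING MODEL, PROVED IN TREE — determinant versus padded
permanent has NO occurrence obstructions
(`Literature.Computability.AlgebraicComplexity.bip_no_occurrence_obstruction_succ_holds`, BIP19 Thm
1.4) while its S-analogue
(VNP ⊄ closure(VBP)) is open: the P_O-shape statement is a theorem exactly where the containment
question is not; (b) IN MODEL, PROVED IN
TREE (parallel Schur–Weyl vocabulary `isotypicSum₁₂₃ … kroneckerPow`; module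
`MatMulOccurrenceObstructionsRefutation`, cited not
imported: its olean is not built on the farm at filing time) — the only printed GL-occurrence
obstruction family against
⟨m,m,m⟩ above the trivial scale is not one:
`isotypicSum_bi2013Hook_kroneckerPow_matMulTensor_eq_zero` (type λ(κ)³ does not occur for
⟨m,m,m⟩ in degree 3κ+1, 2κ+1 = m², every odd m ≥ 3), a regime r = (3m²−3)/2 < 2m² − ⌈log₂ m⌉ − 1 ≤
R̲(⟨m,m,m⟩) where the containment
(S-analogue) is FALSE — P_O's instance holds where S's instance fails; (c) PLAN-ONLY RUNG in the
route's own vocabulary: `stub_padInheritance`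
(P_O restricted to types with a factor of more than n² parts; technique: torus weights + Bruhat
normal form B·w·B of the padding matrix)
and the prolongation rung «P_O in degrees d ≤ m» (I(σ_m)_d = 0 for d ≤ m by polarisation). bc6
declared 6 / in-cone 5 / aside 2
(RankEventuallyQuadratic, NoMultiplicityObstruction are asides referenced by the crux definitions;
Assembly optional). bc7 crux probes:
see NOTES (run at filing). bc8 placement: all three cruxes OUTSIDE every catalogued
MatrixMultiplication barrier (BARRIERS section: the
catalogued barriers bound lower-bound METHODS or fixed-intermediate-tensor METHODS; these cruxes are
no-obstruction statements between two
orbit closures) — [corpus:paper:arxiv-1011.1350 p.6] BI11 Thm 4.6 is the one printed no-go in this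
exact setting and it SUPPORTS P_O;
no hits for "occurrence obstruction|unit tensor" beyond the arXiv items of NOVELTY in galaxy
(pdf/panama/crabby). bc9 method_family =
gct occurrence-obstruction multiplicity-obstruction invariant-theory; ladder_ceiling = unknown (no
printed ceiling on NO-obstruction /
saturation theorems: BIP19 and IP17 are such theorems at full strength in their models; the printed
CEILINGS — BIP19, DIP20, BI11 Thm 4.6,
Buczyński's cactus barrier — cap LOWER-bound methods); ceiling_lift = the declared residual
MultiplicityDecides (completeness), declared
crux; ceiling_sources = [BurgisserIkenmeyerPanova2019: Thm 1.4 | DorflerIkenmeyerPanova2020: Thm 2.3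
| corpus:paper:arxiv-1011.1350 p.6 |
Literature/Barriers/MatrixMultiplication/LinearRankMethodBarrier.lean].

Novelty: Searches (2026-08-30): rg over Theses/*.lean (80) + Literature/Computability/AlgebraicComplexity
(GCT files: GCTObstructions, MatMulOccurrenceObstructions(+Refutation),
UnitTensorSLObstructions(+Occurrence), IsotypicOccurrence*, UnitTensorMomentPolytope*,
BIPNoOccurrence, DIP20*, Bur24GCTOpenProblems) for "occurrence obstruction|isotypic|highest
weight|moment polytope|Kronecker" (13 Theses hits, all lower-bound side or stronger-hypothesis side;
0 statements of shape P_O/P_M/L/D); ledger negatives --problem MatrixMultiplication (12; none in GCT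
language); lit search --hybrid "occurrence obstructions matrix multiplication unit tensor border
rank" (corpus: paper:arxiv-1011.1350 pp.2,6,7-9; paper:arxiv-2411.03444 p.9; paper:arxiv-2503.22633
pp.2,5); lit search "no occurrence obstructions" geometric complexity (BIP19 doi:10.1090/jams/908,
IP17 arXiv:1512.03798, GIP17 arXiv:1611.00827, DIP20 arXiv:1901.04576); lit galaxy search
"occurrence obstruction|moment polytope|unit tensor" --star all (pdf hits = the arXiv items above;
no upper-bound-side formulation).
Nearest prior art found: BurgisserIkenmeyer2011 (STOC 2011 = arXiv:1011.1350: the dictionary, Thm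
4.6 no G_s-obstructions, Lemma 6.1, Problem 8.3); BurgisserIkenmeyerPanova2019 (no occurrence
obstructions, det/per); DorflerIkenmeyerPanova2020 (multiplicity strictly stronger than occurrence);
tree Theses IsotypicSaturation (polytope saturation of spectral points ⇒ ω = 2: a STRONGER-than-S
hypothesis in the same vocabulary).
Delt  [refs: 10.1090/jams/908, 1512.03798, 1611.00827, 1901.04576, 1011.1350, paper:arxiv-1011.1350, paper:arxiv-2411.03444, paper:arxiv-2503.22633, doi:10.1090/jams/908, BurgisserIkenmeyer2011, BurgisserIkenmeyerPanova2019, DorflerIkenmeyerPanova2020]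

Barriers (technique_class: GCT, representation-theory, invariant-theory): - technique_class: GCT, representation-theory, invariant-theory
- Literature.Barriers.MatrixMultiplication.UniversalMethodBarrier: outside — the barrier bounds what
powers/degenerations of a FIXED tensor can certify; P_O/P_M/L/D quantify over obstructions between
two orbit closures and certify no bound through a fixed intermediate tensor.
- Literature.Barriers.MatrixMultiplication.IrreversibilityBarrier: outside for the same reason (no
intermediate tensor, no asymptotic conversion rate).
- Literature.Barriers.MatrixMultiplication.UnstableTensorBarrier: does not apply as a barrier;
instability/moment-polytope data are the COARSEST shadow of P_O (T_O2) and ⟨m⟩, ⟨n,n,n⟩ are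
polystable (BI11 Prop 4.2).
- Literature.Barriers.MatrixMultiplication.LinearRankMethodBarrier: refutation-side only — refuting
P_O/P_M needs a super-quadratic border-rank lower bound for ⟨n,n,n⟩, beyond every known lower-bound
method (acknowledged: the pieces are not cheaply killable; the instruments are finite-n questions
instead).
- Literature.Barriers.MatrixMultiplication.BoundedRankFrameBarrier: does not apply (no
frame/rank-method certificate).
- Literature.Barriers.MatrixMultiplication.RectangularBarrier: does not apply (square shapes only).
- Literature.Barriers.MatrixMultiplication.TricoloredSumFreeBarrier: does not apply (no
group-theoretic design); likewise NilpotentGroup/Normalizer/Quasirandom/YoungSubgroup barriers.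
- Literature.Barriers.MatrixMultiplication.EquivoluminousBarrier: does not apply

History (route lifecycle, newest last):
- 2026-08-30T10:57:05Z · rev 6: restated InvariantSaturation (stmt-MatrixMultiplication-32150) — repair (self-caught, gen 10): InvariantSaturation rev-5 text was VACUOUS — weight k on the FIRST n² coordinates carries no weight vectors in the kernel's upper- (planner-decomp-mm-lens-3-g10-0)

sub-problem: MatrixMultiplication · status: open · opened planner-decomp-mm-lens-3-g6-0 2026-08-30T06:06:11Z · rev 14 · ledger route-MatrixMultiplication-ObstructionDescent
GENERATED by the gate from the ledger (D-0016/17). Provers cite these decls: `theorem foo : Summit.MatrixMultiplication.MatrixMultiplication.Theses.ObstructionDescent.<Decl> := …` in Summits/MatrixMultiplication/MatrixMultiplication/Theorems/<Name>.lean.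
-/

namespace Summit.MatrixMultiplication.MatrixMultiplication.Theses.ObstructionDescent

open scoped BigOperators Topology Manifold Classical MeasureTheory ProbabilityTheory Matrix InnerProductSpace ComplexConjugate ContinuousMap
open Filter Set Function TopologicalSpace MeasureTheory

attribute [summit_statement] _root_.MatrixMultiplication

/-- item stmt-MatrixMultiplication-29040 · crux · rank 2 · open · by planner
why it might fail: false iff some GL_m^3-type occurs for pad_m<n,n,n> but not for <m> with m >= n^(2+eps) for infinitely many n - an occurrence obstruction proving omega > 2; none is known at any super-n^2 scale (BI11 Lemma 6.1 reaches n^2+O(1); BI13 Rem 4.7 is refuted in the tree).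
sources: BurgisserIkenmeyer2011, BurgisserIkenmeyer2013, DorflerIkenmeyerPanova2020, arXiv:2503.22633
[crux] P_O «no occurrence obstruction above the quadratic scale»: for every τ > 2 there is n₀ such
that for all n ≥ n₀ and all m with n² ≤ m and n^τ ≤ m, for every type Λ ∈ (ℕ^m)³ and degree d,
writing W for the set of weight vectors of type Λ and degree d (homogeneous degree-d polynomial
functions on ℂ^m ⊗ ℂ^m ⊗ ℂ^m that are B_m³-semi-invariant with character Λ under the substitution
action of upper-triangular matrices): if every f ∈ W vanishes on the orbit GL_m³·⟨m⟩ of the unit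
tensor then every f ∈ W vanishes on GL_m³·pad_m⟨n,n,n⟩ — every type occurring for pad_m⟨n,n,n⟩
occurs for ⟨m⟩ (BI11 §3.1: S(pad_m⟨n,n,n⟩) ⊆ S(⟨m⟩) in each degree). Tag WEAKER (S ⟹ P_O kernel
`noOccurrenceObstruction_of_summit`; P_O ⟹ S open and false-by-analogy: DIP20, BIP19, BI11 Thm 4.6);
leaf UNDECIDED-in-print → INSTRUMENTABLE (T_O1, T_O3) + IDEA-NEEDED (BIP19-style «all relevant types
occur for closure(GL³⟨m⟩)» via BI11 Thm 5.x). [difficulty: open-problem] -/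
@[route_item "route-MatrixMultiplication-ObstructionDescent", crux]
def NoOccurrenceObstruction : Prop :=
  ∀ τ : ℝ, 2 < τ → ∃ n₀ : ℕ, ∀ n m : ℕ, n₀ ≤ n → ∀ h : n * n ≤ m, (n : ℝ) ^ τ ≤ (m : ℝ) → ∀ (Λ : Fin 3 → Fin m → ℕ) (d : ℕ) (W : Set (MvPolynomial (Fin m × Fin m × Fin m) ℂ)), W = {f | f.IsHomogeneous d ∧ ∀ A B C : Matrix (Fin m) (Fin m) ℂ, ((∀ i j : Fin m, j < i → A i j = 0) ∧ ∀ i : Fin m, A i i ≠ 0) → ((∀ i j : Fin m, j < i → B i j = 0) ∧ ∀ i : Fin m, B i i ≠ 0) → ((∀ i j : Fin m, j < i → C i j = 0) ∧ ∀ i : Fin m, C i i ≠ 0) → ∀ t : Fin m → Fin m → Fin m → ℂ, MvPolynomial.aeval (fun p : Fin m × Fin m × Fin m => Literature.Computability.AlgebraicComplexity.actTensor A B C t p.1 p.2.1 p.2.2) f = (∏ i, A i i ^ Λ 0 i) * (∏ i, B i i ^ Λ 1 i) * (∏ i, C i i ^ Λ 2 i) * MvPolynomial.aeval (fun p : Fin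 m × Fin m × Fin m => t p.1 p.2.1 p.2.2) f} → (∀ f ∈ W, ∀ A B C : Matrix (Fin m) (Fin m) ℂ, A.det ≠ 0 → B.det ≠ 0 → C.det ≠ 0 → MvPolynomial.aeval (fun p : Fin m × Fin m × Fin m => Literature.Computability.AlgebraicComplexity.actTensor A B C (Literature.Computability.AlgebraicComplexity.unitTensor ℂ m) p.1 p.2.1 p.2.2) f = 0) → ∀ f ∈ W, ∀ A B C : Matrix (Fin m) (Fin m) ℂ, A.det ≠ 0 → B.det ≠ 0 → C.det ≠ 0 → MvPolynomial.aeval (fun p : Fin m × Fin m × Fin m => Literature.Computability.AlgebraicComplexity.actTensor A B C ((fun a b c : Fin m => ∑ r : (Fin n × Fin n) × (Fin n × Fin n) × (Fin n × Fin n), (if Fin.castLE h (finProdFinEquiv r.1) = a ∧ Fin.castLE h (finProdFinEquiv r.2.1) = b ∧ Fin.castLE h (finProdFinEquiv r.2.2) = c then (1 : ℂ) else 0) * Literature.Computability.AlgebraicComplexity.matMulTensor ℂ n n n r.1 r.2.1 r.2.2)) p.1 p.2.1 p.2.2) f = 0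

/-- item stmt-MatrixMultiplication-27205 · aside · rank 9 · open · by planner
why it might fail: implied by ω=2 (via E): fails only if ω>2 is witnessed by a LEVEL-FREE trace identity of poly degree non-zero at ⟨n,n,n⟩ for m ≥ n^{2+ε} i.o.; the only known stable families (rank methods) are provably blind there (cactus wall 6n²−4; EGOW18), so nothing known threatens or proves it
sources: LandsbergGCT2017, Procesi1976, Razmyslov1974, Lebruyn2008, BurgisserIkenmeyer2011, EfremenkoGargOliveiraWigderson2018
[aside · NEC (E ⟹ it, kernel: stableTraceIdentitiesBlind_of_noPolyDegreeObstruction, 0 sorry) ·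
WEAKER than E = NoPolyDegreeObstruction (30889) · UNDECIDED · banked context beneath the attacked
leaf E, not a cut piece · gen 19 (decomp-mm-lens-3), THIRD LANGUAGE = trace diagrams] STABLE TRACE
IDENTITIES ARE BLIND AT ⟨n,n,n⟩. Dictionary (LandsbergGCT2017 Prop 4.1.3.1; Procesi1976 /
Razmyslov1974 / Lebruyn2008 p.39, p.100): the connected stabiliser of ⟨n,n,n⟩ = Σ
e_{κν}⊗e_{κμ}⊗e_{μν} in GL(ℂ^{n×n})³ is H_n = image of GL_n×GL_n×GL_n (one factor per shared index
κ, μ, ν); ⟨n,n,n⟩ is H_n-fixed and H_n is reductive, so (Reynolds) a degree-d equation of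
σ_m((ℂ^{n×n})^{⊗3}) is non-zero at ⟨n,n,n⟩ only if an H_n-INVARIANT one is, and (first fundamental
theorem) the H_n-invariants of degree d are spanned by the TRACE DIAGRAMS Tr_σ, σ = (σ_κ,σ_μ,σ_ν) ∈
(S_d)³ (Tr_σ(t) = Σ_{κ,μ,ν:[d]→[n]} Π_s t_{(κ s,ν s),(κ σ_κ s, μ s),(μ σ_μ s, ν σ_ν s)}; on a⊗b⊗c,
a,b,c ∈ Mat_n, a product of traces of words abcabc… along the cycles of σ_ν σ_μ σ_κ — the quiver
•⇉•⇉•⇉• with m arrows). KERNEL (Theorems/ObstructionDescentTraceDiagrams.lean, 0 sorry): THE CYCLE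
FORMULA Tr_σ(⟨n,n,n⟩) = n^{cyc σ_κ + cyc σ_μ + cyc σ -/
@[route_item "route-MatrixMultiplication-ObstructionDescent"]
def StableTraceIdentitiesBlind : Prop :=
  ∀ c : ℕ, ∀ τ : ℝ, 2 < τ → ∃ n₀ : ℕ, ∀ n m d : ℕ, n₀ ≤ n → n * n ≤ m → (n : ℝ) ^ τ ≤ (m : ℝ) → d ≤ m ^ c → ∀ coef : Equiv.Perm (Fin d) × Equiv.Perm (Fin d) × Equiv.Perm (Fin d) → ℂ, (∀ ℓ : ℕ, ∀ t : (Fin ℓ × Fin ℓ) → (Fin ℓ × Fin ℓ) → (Fin ℓ × Fin ℓ) → ℂ, Literature.Computability.AlgebraicComplexity.tensorRank t ≤ m → ∑ σ : Equiv.Perm (Fin d) × Equiv.Perm (Fin d) × Equiv.Perm (Fin d), coef σ * ∑ κ : Fin d → Fin ℓ, ∑ μ : Fin d → Fin ℓ, ∑ ν : Fin d → Fin ℓ, ∏ s : Fin d, t (κ s, ν s) (κ (σ.1 s), μ s) (μ (σ.2.1 s), ν (σ.2.2 s)) = 0) → ∑ σ : Equiv.Perm (Fin d) × Equiv.Perm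 (Fin d) × Equiv.Perm (Fin d), coef σ * (n : ℂ) ^ ((σ.1.cycleFactorsFinset.card + (Finset.univ.filter fun x : Fin d => σ.1 x = x).card) + (σ.2.1.cycleFactorsFinset.card + (Finset.univ.filter fun x : Fin d => σ.2.1 x = x).card) + (σ.2.2.cycleFactorsFinset.card + (Finset.univ.filter fun x : Fin d => σ.2.2 x = x).card)) = 0

/-- item stmt-MatrixMultiplication-27291 · aside · rank 9 · open · by planner
why it might fail: a family t_m in a sub-format (C^N)^⊗3 with N ≤ (m+4)/6 (inside the cactus variety κ_m: invisible to every determinantal equation of σ_m) and bR(t_m) > m^{1+δ} that every non-determinantal degree-≤m^c equation of σ_m annihilates, for each c; no decided instance either way.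
sources: BurgisserClausenShokrollahi1997, Blaser2013, HauensteinIkenmeyerLandsberg2013, LandsbergGCT2017, Buczynski2026, EfremenkoGargOliveiraWigderson2018
[aside · LAW beneath the declared joint residual JointBlindnessDecides (30890) · MM-free · UNDECIDED
· banked context, never staffed · gen 20 (decomp-mm-lens-3), DEGREE-GENERATION axis] SECANT TESTS
ARE SOUND UP TO POLYNOMIAL LOSS (G₃): for every δ>0 there are c, m₀ such that for m ≥ m₀ every
tensor t ∈ ℂ^m⊗ℂ^m⊗ℂ^m lying in the common zero locus of the degree-≤m^c equations of
σ_m(ℂ^m⊗ℂ^m⊗ℂ^m) (orbit phrasing of E and A: polynomials vanishing on GL_m³·⟨m⟩) lies in σ_r, r =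
⌊m^{1+δ}⌋ (the zero locus of ALL polynomials vanishing on the rank-≤r tensors), i.e. — Alder, BCS
Thm (20.3), tree alder_secantVariety_eq_setOf_algBorderRank_le_holds — has border rank bR(t) ≤
m^{1+δ} (kernel secantTestsSoundUpToPolyLoss_iff). KERNEL
(Theorems/ObstructionDescentSecantGeneration.lean, 0 sorry, std axioms): E ∧ G₃ ⟹ ω(ℂ)=2
(summit_of_noPolyDegreeObstruction_of_secantTestsSoundUpToPolyLoss: E puts pad_m⟨n,n,n⟩,
m=⌈n^{2+δ}⌉, through every degree-≤m^c test; G₃ gives bR(pad) ≤ m^{1+δ}; restriction bR(⟨n,n,n⟩) ≤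
bR(pad) (algBorderRank_precomp_le); Bini–Bläser Thm 6.6 (Blaser2013_thm66_holds.cubic) gives ω ≤
(1+δ)(2+2δ)), hence G₃ ⟹ JointBlindnessDecides (jointBlindnessDecides_of_secantTestsSoundUpToPoly -/
@[route_item "route-MatrixMultiplication-ObstructionDescent", crux]
def SecantTestsSoundUpToPolyLoss : Prop :=
  ∀ δ : ℝ, 0 < δ → ∃ c m₀ : ℕ, ∀ m : ℕ, m₀ ≤ m → ∀ t : Fin m → Fin m → Fin m → ℂ, (∀ f : MvPolynomial (Fin m × Fin m × Fin m) ℂ, f.totalDegree ≤ m ^ c → (∀ A B C : Matrix (Fin m) (Fin m) ℂ, A.det ≠ 0 → B.det ≠ 0 → C.det ≠ 0 → MvPolynomial.aeval (fun p : Fin m × Fin m × Fin m => Literature.Computability.AlgebraicComplexity.actTensor A B C (Literature.Computability.AlgebraicComplexity.unitTensor ℂ m) p.1 p.2.1 p.2.2) f = 0) → MvPolynomial.aeval (fun p : Fin m × Fin m × Fin m => t p.1 p.2.1 p.2.2) f = 0) → ∀ f : MvPolynomial (Fin m × Fin m × Fin m) ℂ, (∀ s : Fin m → Fin m → Fin m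 → ℂ, Literature.Computability.AlgebraicComplexity.tensorRank s ≤ ⌊(m : ℝ) ^ (1 + δ)⌋₊ → MvPolynomial.aeval (fun p : Fin m × Fin m × Fin m => s p.1 p.2.1 p.2.2) f = 0) → MvPolynomial.aeval (fun p : Fin m × Fin m × Fin m => t p.1 p.2.1 p.2.2) f = 0

/-- item stmt-MatrixMultiplication-27417 · aside · rank 9 · closed · proved by Summit.MatrixMultiplication.MatrixMultiplication.Theorems.ObstructionDescentKroneckerRankMethods.kroneckerRankMethodsBlind_holds (planner) · by planner
why it might fail: none past the wall — PROVED (kernel, from Buczynski2026_cactusBarrier_segre_holds in the power format regrouped to three factors of dim n^{2k}); filed so the degree-k/Kronecker-power class (DM26, GMOW19 T_k-rank) lands against a named decl. Risk: only the coarse-normalised class is covered.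
sources: Buczynski2026, DolezalekMichalek2026, GargMakamOliveiraWigderson2019, EfremenkoGargOliveiraWigderson2018, LandsbergGCT2017, BurgisserIkenmeyer2011
[aside · DECIDED (kernel Theorems/ObstructionDescentKroneckerRankMethods.lean, 0 sorry, std axioms;
closes by its theorem kroneckerRankMethodsBlind) · METHOD axis of E = NoPolyDegreeObstruction
(30889), rung R2^⊠ beneath the declared joint residual JointBlindnessDecides (30890) · banked
context, never staffed · gen 21 (decomp-mm-lens-3)] KRONECKER-POWER RANK METHODS ARE BLIND AT
QUADRATIC SCALE: for every degree k, every linear map L : ((ℂ^m)^{⊗k})^{⊗3} → Mat_{p×q}(ℂ) (index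
type Fin k → Fin m in each factor) with rk L(w⊗u⊗v) ≤ ρ on the rank-one tensors of that three-factor
format, and all A, B, C ∈ Mat_m(ℂ): past the power-format cactus wall 6n^{2k} − 4 ≤ m^k one has rk
L(((A,B,C)·pad_m⟨n,n,n⟩)^{⊠k}) ≤ ρ·m^k — the maximum the method takes on {T^{⊠k} : T ∈ σ_m} ⊆
σ_{m^k} (SUBMULTIPLICATIVE threshold). Hence no σ_m-equation of the Kronecker-power determinantal
class — a (ρm^k+1)-minor of T ↦ L(T^{⊠k}), any k, any L; every homogeneous degree-k polynomial
matrix map T ↦ M(T) is Λ(T^{⊠k}) with Λ linear, so this is the class of ALL degree-k polynomial rank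
methods normalised by the σ_{m^k}-threshold, containing the Kronecker squares/powers of Strassen's
commutator and of the Koszul–Youn -/
@[route_item "route-MatrixMultiplication-ObstructionDescent"]
def KroneckerRankMethodsBlind : Prop :=
  ∀ (k n m : ℕ) (h : n * n ≤ m), 6 * n ^ (2 * k) - 4 ≤ m ^ k → ∀ (p q ρ : ℕ) (L : ((Fin k → Fin m) → (Fin k → Fin m) → (Fin k → Fin m) → ℂ) →ₗ[ℂ] Matrix (Fin p) (Fin q) ℂ), (∀ w u v : (Fin k → Fin m) → ℂ, (L (Literature.Computability.AlgebraicComplexity.triad w u v)).rank ≤ ρ) → ∀ A B C : Matrix (Fin m) (Fin m) ℂ, (L (Literature.Computability.AlgebraicComplexity.kroneckerPow (Literature.Computability.AlgebraicComplexity.actTensor A B C (fun a b c : Fin m => ∑ r : (Fin n × Fin n) × (Fin n × Fin n) × (Fin n × Fin n), (if Fin.castLE h (finProdFinEquiv r.1) = a ∧ Fin.castLE h (finProdFinEquiv r.2.1) = b ∧ Fin.castLE h (finProdFinEquiv r.2.2) = c then (1 : ℂ) else 0) * Literature.Computability.AlgebraicComplexity.matMulTensor ℂ n n n r.1 r.2.1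 r.2.2)) k)).rank ≤ ρ * m ^ k

-- `KroneckerRankMethodsBlind` holds: proved by `Summit.MatrixMultiplication.MatrixMultiplication.Theorems.ObstructionDescentKroneckerRankMethods.kroneckerRankMethodsBlind_holds` (its module imports this route file, so no `_holds` link can be stated here).

/-- item stmt-MatrixMultiplication-27477 · aside · rank 9 · closed · proved by Summit.MatrixMultiplication.MatrixMultiplication.Theorems.ObstructionDescentKroneckerStable.fineKroneckerRankMethodsBlind_holds (planner) · by planner
why it might fail: none past the wall — PROVED (kernel: induction on k peeling one Kronecker factor + tree theorem Buczynski2026_cactusBarrier_segre_holds on the pad); filed so the degree-k Kronecker-power determinantal class (CGLV22 §3, DM26, GMOW19) lands against a named decl. Risk: optimal thresholds not covered.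
sources: Buczynski2026, DolezalekMichalek2026, ConnerGesmundoLandsbergVentura2022, GargMakamOliveiraWigderson2019, LandsbergGCT2017, BurgisserIkenmeyer2011
[aside · DECIDED (kernel Theorems/ObstructionDescentKroneckerStable.lean, 0 sorry, std axioms;
closes by its theorem fineKroneckerRankMethodsBlind) · METHOD axis of E = NoPolyDegreeObstruction
(30889), rung R2^{⊠,fine} «the cactus wall is Kronecker-stable»] A Kronecker-power rank method of
degree k is a linear map Λ on the k-th Kronecker-power format ((ℂ^m)^{⊗k})^{⊗3} applied to T^{⊠k},
FINELY normalised by ρ = max rank of Λ on the 3k-fold (fine) rank-one tensors ⊠_s (w_s⊗u_s⊗v_s); it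
certifies bR(T) > r iff rk Λ(T^{⊠k}) > ρ·r^k (T ∈ σ_r ⇒ T^{⊠k} is a limit of sums of r^k fine
rank-one tensors). Every homogeneous degree-k polynomial matrix map T ↦ M(T) is such a Λ(T^{⊠k});
the class contains the Kronecker powers of all flattenings / Koszul–Young flattenings (CGLV22 §3 on
T^{⊠2}, T^{⊠3}) and is the class whose threshold ρ·r^k the Kronecker–Koszul equations of
Doležálek–Michałek 2026 lower by the factor χ_G(r)/r^k to go beyond cactus at MINIMAL border rank.
STATEMENT: past the SAME wall as the linear class (item 30921), 6n²−4 ≤ m, independent of k, rk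
Λ(((A,B,C)·pad_m⟨n,n,n⟩)^{⊠k}) ≤ ρ·m^k for ALL A,B,C ∈ Mat_m — no finely-normalised Kronecker-power
rank method of any degree separate -/
@[route_item "route-MatrixMultiplication-ObstructionDescent"]
def FineKroneckerRankMethodsBlind : Prop :=
  ∀ (k n m : ℕ) (h : n * n ≤ m), 6 * n ^ 2 - 4 ≤ m → ∀ (p q ρ : ℕ) (L : ((Fin k → Fin m) → (Fin k → Fin m) → (Fin k → Fin m) → ℂ) →ₗ[ℂ] Matrix (Fin p) (Fin q) ℂ), (∀ w u v : Fin k → Fin m → ℂ, (L (fun a b c => ∏ s, Literature.Computability.AlgebraicComplexity.triad (w s) (u s) (v s) (a s) (b s) (c s))).rank ≤ ρ) → ∀ A B C : Matrix (Fin m) (Fin m) ℂ, (L (Literature.Computability.AlgebraicComplexity.kroneckerPow (Literature.Computability.AlgebraicComplexity.actTensor A B C (fun a b c : Fin m => ∑ r : (Fin n × Fin n) × (Fin n × Fin n) × (Fin n × Fin n), (if Fin.castLE h (finProdFinEquiv r.1) = a ∧ Fin.castLE h (finProdFinEquiv r.2.1) = b ∧ Fin.castLE h (finProdFinEquiv r.2.2)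 = c then (1 : ℂ) else 0) * Literature.Computability.AlgebraicComplexity.matMulTensor ℂ n n n r.1 r.2.1 r.2.2)) k)).rank ≤ ρ * m ^ k

-- `FineKroneckerRankMethodsBlind` holds: proved by `Summit.MatrixMultiplication.MatrixMultiplication.Theorems.ObstructionDescentKroneckerStable.fineKroneckerRankMethodsBlind_holds` (its module imports this route file, so no `_holds` link can be stated here).

/-- item stmt-MatrixMultiplication-27605 · aside · rank 9 · closed · proved by Summit.MatrixMultiplication.MatrixMultiplication.Theorems.ObstructionDescentHullDescent.polyDegreeHullLaws_holds (planner) · by planner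
why it might fail: none — PROVED (kernel ObstructionDescentHullCalculus.polyDegreeHullLaws_holds, from Blaser2013_lemma58, tensorRank_directSumTensor_le_add, tensorRestrictsTo_actTensor); filed so the object R_D / Hull_D and the violation-descent reading of E land against a named decl. Risk: bookkeeping only.
sources: Blaser2013, BurgisserClausenShokrollahi1997, LandsbergGCT2017, ChristandlVranaZuiddam2023, BurgisserIkenmeyer2011
[aside · DECIDED (kernel Theorems/ObstructionDescentHullCalculus.lean, 0 sorry, std axioms; closes
by its theorem polyDegreeHullLaws_holds) · OBJECT axis of E = NoPolyDegreeObstruction (30889)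
beneath the declared joint residual JointBlindnessDecides (30890) · banked context, never staffed ·
gen 22 (decomp-mm-lens-3)] POLY-DEGREE HULL LAWS. For a format ℂ^α⊗ℂ^β⊗ℂ^γ write Hull_D(σ_m) := {s :
every polynomial of total degree ≤ D vanishing on all tensors of rank ≤ m vanishes at s} (the
degree-D hull of the m-th secant variety; E says exactly ⟨n,n,n⟩ ∈ Hull_{m^c}(σ_m) of the corner
format at the cells n² ≤ m, n^τ ≤ m — kernel noPolyDegreeObstruction_iff_hull). The hulls are (1)
closed under (A⊗B⊗C)· for ARBITRARY matrices between formats (restriction, relabelling,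
zeroing-out), (2) ⊕-hereditary Hull_D(σ_m) ⊕ Hull_D(σ_m') ⊆ Hull_D(σ_{m+m'}), (3) ⊠-hereditary
Hull_D(σ_m) ⊠ Hull_D(σ_m') ⊆ Hull_D(σ_{m·m'}) at the SAME degree D (two-step slice substitution:
freezing one Kronecker/direct-sum slot is a linear change of variables, so degree is kept, and rank
is ⊕-subadditive / ⊠-submultiplicative). Hence the degree-truncated border rank R_D(t) := min{m : t
∈ Hull_D(σ_m)} is restriction-monoton -/
@[route_item "route-MatrixMultiplication-ObstructionDescent"]
def PolyDegreeHullLaws : Prop :=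
  (∀ (α β γ α' β' γ' : Type) [Fintype α] [Fintype β] [Fintype γ] [Fintype α'] [Fintype β'] [Fintype γ'] (m D : ℕ) (s : α → β → γ → ℂ), (∀ f : MvPolynomial (α × β × γ) ℂ, f.totalDegree ≤ D → (∀ u : α → β → γ → ℂ, Literature.Computability.AlgebraicComplexity.tensorRank u ≤ m → MvPolynomial.aeval (fun p : α × β × γ => u p.1 p.2.1 p.2.2) f = 0) → MvPolynomial.aeval (fun p : α × β × γ => s p.1 p.2.1 p.2.2) f = 0) → ∀ (A : Matrix α' α ℂ) (B : Matrix β' β ℂ) (C : Matrix γ' γ ℂ), ∀ g : MvPolynomial (α' × β' × γ') ℂ, g.totalDegree ≤ D → (∀ u : α' → β' → γ' → ℂ, Literature.Computability.AlgebraicComplexity.tensorRank u ≤ m → MvPolynomial.aeval (fun p : α' × β' × γ' => u p.1 p.2.1 p.2.2) g = 0) → MvPolynomial.aeval (fun p : α' × β' × γ' => Literature.Computability.AlgebraicComplexity.actTensor A B C s p.1 p.2.1 p.2.2) g = 0) ∧ (∀ (α β γ α' β' γ' : Type) [Fintype α] [Fintype β] [Fintype γ] [Fintype α'] [Fintype β']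 [Fintype γ'] (m m' D : ℕ) (s : α → β → γ → ℂ) (t : α' → β' → γ' → ℂ), (∀ f : MvPolynomial (α × β × γ) ℂ, f.totalDegree ≤ D → (∀ u : α → β → γ → ℂ, Literature.Computability.AlgebraicComplexity.tensorRank u ≤ m → MvPolynomial.aeval (fun p : α × β × γ => u p.1 p.2.1 p.2.2) f = 0) → MvPolynomial.aeval (fun p : α × β × γ => s p.1 p.2.1 p.2.2) f = 0) → (∀ g : MvPolynomial (α' × β' × γ') ℂ, g.totalDegree ≤ D → (∀ u : α' → β' → γ' → ℂ, Literature.Computability.AlgebraicComplexity.tensorRank u ≤ m' → MvPolynomial.aeval (fun p : α' × β' × γ' => u p.1 p.2.1 p.2.2) g = 0) → MvPolynomial.aeval (fun p : α' × β' × γ' => t p.1 p.2.1 p.2.2) g = 0) → (∀ F : MvPolynomial ((α ⊕ α') × (β ⊕ β') × (γ ⊕ γ')) ℂ, F.totalDegree ≤ D → (∀ u : α ⊕ α' → β ⊕ β' → γ ⊕ γ' → ℂ, Literature.Computability.AlgebraicComplexity.tensorRank u ≤ m + m' → MvPolynomial.aeval (fun p : (α ⊕ α') × (β ⊕ β') ×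 (γ ⊕ γ') => u p.1 p.2.1 p.2.2) F = 0) → MvPolynomial.aeval (fun p : (α ⊕ α') × (β ⊕ β') × (γ ⊕ γ') => Literature.Computability.AlgebraicComplexity.directSumTensor s t p.1 p.2.1 p.2.2) F = 0) ∧ (∀ F : MvPolynomial ((α × α') × (β × β') × (γ × γ')) ℂ, F.totalDegree ≤ D → (∀ u : α × α' → β × β' → γ × γ' → ℂ, Literature.Computability.AlgebraicComplexity.tensorRank u ≤ m * m' → MvPolynomial.aeval (fun p : (α × α') × (β × β') × (γ × γ') => u p.1 p.2.1 p.2.2) F = 0) → MvPolynomial.aeval (fun p : (α × α') × (β × β') × (γ × γ') => Literature.Computability.AlgebraicComplexity.kroneckerTensor s t p.1 p.2.1 p.2.2) F = 0))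

-- `PolyDegreeHullLaws` holds: proved by `Summit.MatrixMultiplication.MatrixMultiplication.Theorems.ObstructionDescentHullDescent.polyDegreeHullLaws_holds` (its module imports this route file, so no `_holds` link can be stated here).

/-- item stmt-MatrixMultiplication-27778 · aside · rank 9 · closed · proved by Summit.MatrixMultiplication.MatrixMultiplication.Theorems.ObstructionDescentGapOne.gapOneEquationsVanish_holds (planner) · by planner
why it might fail: none on paper (NODE-g23 Thm B: Casimir/Jucys–Murphy lower bound T ≥ (d/2)(d/N−N) on (ℂ^N)^{⊗d} against the forced eigenvalue −C(d,2)); Lean risk = the polarisation bridge MvPolynomial.IsHomogeneous ↔ symmetric coefficient tensor and a finite Hermitian-sum PSD argument (est. 2 files).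
sources: LandsbergManivel2004, LandsbergManivel2006, LandsbergGCT2017, HauensteinIkenmeyerLandsberg2013
[aside · UNDECIDED, proof on paper (NODE-g23 §2, Theorem B) · DEGREE axis of E =
NoPolyDegreeObstruction (30889), MM-free, beneath the declared joint residual 30890 · banked
context, never staffed · gen 23 (decomp-mm-lens-3)] GAP-ONE EMPTINESS. For N ≥ 2 and d ≥ 3N−2 the
ideal of σ_{d−1}(P^{N−1}×P^{N−1}×P^{N−1}) is EMPTY in degree d: a homogeneous degree-d polynomial on
ℂ^N⊗ℂ^N⊗ℂ^N vanishing on every tensor of rank < d is zero (equivalently the prolongation ideal J =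
(S²A⊗S²B⊗S²C) ⊂ Sym(A⊗B⊗C) contains all forms of degree ≥ 3N−2). Proof (paper): f ∈ I_d(σ_{d−1}) iff
its polarisation F kills x⊙x⊙V^{⊙(d−2)} (x ∈ Seg) [LandsbergManivel2004 Lemma 3.1/Cor 3.4] iff
(1+X)(1+Y)(1+Z)F = 0 for the transposition (12) acting separately on the A-, B-, C-slots; with
diagonal S_d-invariance this is (X_{ij}+Y_{ij}+Z_{ij})F = −F for every pair, so (T_A+T_B+T_C)F =
−C(d,2)·F with T = Σ_{i<j}(ij) = (Casimir − dN)/2 ≥ (d/2)(d/N − N) (Σ_a E_aa² ≥ d²/N by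
Cauchy–Schwarz, E_ab E_ba ⪰ 0); hence F ≠ 0 forces d(N+3) ≤ N(3N+1) < (3N−2)(N+3). CONTENT FORM
(Theorem A): an isotypic S_λA⊗S_μB⊗S_νC ⊂ I_d(σ_{d−1}) has content sums c(λ)+c(μ)+c(ν) = −d(d−1)/2 —
reproduces exactly I_4(σ_3) = flattenings ⊕ S_211^{⊗3} -/
@[route_item "route-MatrixMultiplication-ObstructionDescent"]
def GapOneEquationsVanish : Prop :=
  ∀ (N d : ℕ), 2 ≤ N → 3 * N ≤ d + 2 → ∀ f : MvPolynomial (Fin N × Fin N × Fin N) ℂ, f.IsHomogeneous d → (∀ t : Fin N → Fin N → Fin N → ℂ, Literature.Computability.AlgebraicComplexity.tensorRank t < d → MvPolynomial.aeval (fun p : Fin N × Fin N × Fin N => t p.1 p.2.1 p.2.2) f = 0) → f = 0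

-- `GapOneEquationsVanish` holds: proved by `Summit.MatrixMultiplication.MatrixMultiplication.Theorems.ObstructionDescentGapOne.gapOneEquationsVanish_holds` (its module imports this route file, so no `_holds` link can be stated here).

/-- item stmt-MatrixMultiplication-27779 · aside · rank 9 · closed · proved by Summit.MatrixMultiplication.MatrixMultiplication.Theorems.ObstructionDescentGapPropagation.gapPropagation_holds (planner) · by planner
why it might fail: none on paper (NODE-g23 Thm C, five-line slot-freeing induction); Lean risk only in the polarisation bookkeeping (symmetric multilinear form of a homogeneous MvPolynomial, multinomial coefficient extraction in char 0).
sources: LandsbergManivel2004, LandsbergGCT2017, HauensteinIkenmeyerLandsberg2013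
[aside · UNDECIDED, proof on paper (NODE-g23 §3, Theorem C) · DEGREE axis of E (30889), MM-free,
pure multilinear algebra · banked context, never staffed · gen 23 (decomp-mm-lens-3)] GAP
PROPAGATION. If I_d(σ_{d−1}((ℂ^N)^{⊗3})) = 0 for all d ≥ d₀, then I_e(σ_m) = 0 for every degree e
with m < e ≤ 2m − d₀ + 2. Proof (paper): f ∈ I_{m+k}(σ_m) ⟹ its polarisation F vanishes on
(x_1,x_1,…,x_k,x_k,v_1,…,v_{m−k}) for x_i ∈ Seg, v_j arbitrary (coefficient of Πs_i²Πt_j in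
f(Σs_ix_i+Σt_jy_j) ≡ 0, then multilinearity) [= LandsbergManivel2004 Prop 3.3 with (a_1,a_2) =
(m−k,k)]; SLOT-FREEING: fixing all but one doubled pair and d₀−2 free slots gives a symmetric
d₀-form killed by x⊙x⊙V^{d₀−2}, hence zero by hypothesis, which frees that pair; this needs (m+k) −
2k + 2 ≥ d₀ at the first step and gets easier afterwards (ideal form: J ⊇ m^{d₀} ⟹ J^k ⊇
m^{d₀+2k−2}). COROLLARY with GapOneEquationsVanish (d₀ = 3N−2): the INITIAL DEGREE of
I(σ_m(P^{N−1}×P^{N−1}×P^{N−1})) is ≥ 2m − 3N + 5 for every m (vs. the classical m+1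
[LandsbergManivel2004 Cor 3.2]); nearly sharp for N < m < 3N/2 where the p = 1 Koszul flattening has
degree 2m+1 [LandsbergGCT2017 §2.4]; with LM04's computed d₀(4) = 6 it gives α(m,4) -/
@[route_item "route-MatrixMultiplication-ObstructionDescent"]
def GapPropagation : Prop :=
  ∀ (N d₀ : ℕ), (∀ d : ℕ, d₀ ≤ d → ∀ f : MvPolynomial (Fin N × Fin N × Fin N) ℂ, f.IsHomogeneous d → (∀ t : Fin N → Fin N → Fin N → ℂ, Literature.Computability.AlgebraicComplexity.tensorRank t < d → MvPolynomial.aeval (fun p : Fin N × Fin N × Fin N => t p.1 p.2.1 p.2.2) f = 0) → f = 0) → ∀ (m e : ℕ), m < e → d₀ + e ≤ 2 * m + 2 → ∀ f : MvPolynomial (Fin N × Fin N × Fin N) ℂ, f.IsHomogeneous e → (∀ t : Fin N → Fin N → Fin N → ℂ, Literature.Computability.AlgebraicComplexity.tensorRank t ≤ m → MvPolynomial.aeval (fun p : Fin N × Fin N × Fin N => t p.1 p.2.1 p.2.2) f = 0) → f = 0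

-- `GapPropagation` holds: proved by `Summit.MatrixMultiplication.MatrixMultiplication.Theorems.ObstructionDescentGapPropagation.gapPropagation_holds` (its module imports this route file, so no `_holds` link can be stated here).

/-- item stmt-MatrixMultiplication-27780 · aside · rank 9 · closed · proved by Summit.MatrixMultiplication.MatrixMultiplication.Theorems.ObstructionDescentDoubleDegree.doubleDegreeBlind_holds (planner) · by planner
why it might fail: none on paper given GapOneEquationsVanish ∧ GapPropagation (both proved on paper, NODE-g23) plus the in-tree corner transfer (ObstructionDescentHullCalculus.hull_actTensor/hull_precomp, formatDegreeBlind_holds); risk = inherits the Lean risk of those two asides.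
sources: LandsbergManivel2004, LandsbergManivel2006, LandsbergGCT2017, BurgisserIkenmeyer2011
[aside · UNDECIDED, proof on paper (NODE-g23 §4, Cor D) · rung R3 of E = NoPolyDegreeObstruction
(30889) strictly above R1 = FormatDegreeBlind (30920, degree ≤ m) on the DEGREE axis, MM-free ·
beneath the declared joint residual 30890 · banked context, never staffed · gen 23
(decomp-mm-lens-3)] DOUBLE-DEGREE BLINDNESS. For 2 ≤ N ≤ m, every polynomial of total degree ≤ 2m −
3N + 4 on ℂ^m⊗ℂ^m⊗ℂ^m vanishing on GL_m³·⟨m⟩ vanishes at (A,B,C)·pad_m(t) for EVERY corner tensor t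
∈ ℂ^N⊗ℂ^N⊗ℂ^N and all matrices A,B,C — whatever the rank of t. With N = n² and t = ⟨n,n,n⟩: E's row
c = 1 (degree ≤ m) is R1 = FormatDegreeBlind; E's next row c = 2 (degree ≤ m²) already contains the
dimension-count equations of σ_m (degree O(m·n²)); R3 doubles the blind window and sits strictly
between rows 1 and 2 of E (it closes no row of E as typed — c ranges over ℕ). Proof (paper): the
pull-back t ↦ f((A,B,C)·pad_m t) is a polynomial of degree ≤ deg f on the corner format vanishing on
{rank t ≤ m} (rank is restriction-monotone; GL_m³·⟨m⟩ is Zariski dense in rank ≤ m — kernels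
formatDegreeBlind_holds / hull_actTensor, hull_precomp); its homogeneous components are equations of
σ_m((ℂ^N)^{⊗3}) of degree ≤ 2m−3N+4 -/
@[route_item "route-MatrixMultiplication-ObstructionDescent"]
def DoubleDegreeBlind : Prop :=
  ∀ (N m : ℕ) (h : N ≤ m), 2 ≤ N → ∀ f : MvPolynomial (Fin m × Fin m × Fin m) ℂ, f.totalDegree + 3 * N ≤ 2 * m + 4 → (∀ A B C : Matrix (Fin m) (Fin m) ℂ, A.det ≠ 0 → B.det ≠ 0 → C.det ≠ 0 → MvPolynomial.aeval (fun p : Fin m × Fin m × Fin m => Literature.Computability.AlgebraicComplexity.actTensor A B C (Literature.Computability.AlgebraicComplexity.unitTensor ℂ m) p.1 p.2.1 p.2.2) f = 0) → ∀ (t : Fin N → Fin N → Fin N → ℂ) (A B C : Matrix (Fin m) (Fin m) ℂ), MvPolynomial.aeval (fun p : Fin m × Fin m × Fin m => Literature.Computability.AlgebraicComplexity.actTensor A B C (fun a b c : Fin m => ∑ q : Fin N × Fin N × Fin N, (if Fin.castLE h q.1 = a ∧ Fin.castLE h q.2.1 = b ∧ Fin.castLE h q.2.2 = c then (1 : ℂ)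 else 0) * t q.1 q.2.1 q.2.2) p.1 p.2.1 p.2.2) f = 0

-- `DoubleDegreeBlind` holds: proved by `Summit.MatrixMultiplication.MatrixMultiplication.Theorems.ObstructionDescentDoubleDegree.doubleDegreeBlind_holds` (its module imports this route file, so no `_holds` link can be stated here).

/-- item stmt-MatrixMultiplication-28214 · aside · rank 9 · open · by planner
why it might fail: none — decided: proved sorry-free in the folder kernel ObstructionDescentOvershoot.lean (family t ≥ 2, k ≥ 12t+10; lean check rc 0), landing via --workitem; the only delicate point, the room arithmetic k > 12t+9, is kernel-checked.
sources: KumarVolk2022, Blaser2013, LandsbergGCT2017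
[aside · DECIDED (TRUE) by the gen-24 kernel ObstructionDescentOvershoot.overshoot_fails_rowTwo
(sorry-free, lean check rc 0; landing --workitem) · METHOD axis beneath E = NoPolyDegreeObstruction
(30889) at E's first open row c = 2 · MM-free · banked context, never staffed · gen 24
(decomp-mm-lens-3)] OVERSHOOT FAILS AT ROW TWO. For every δ > 0 there is τ > 2 (τ = 2 + 1/t, t =
max(2, ⌊3/δ⌋+1)) such that at infinitely many cells (n, m) of E_corner with n² ≤ m, n^τ ≤ m (n =
k^t, m = k^{2t+1}, every k ≥ 12t+10) some equation of σ_m((ℂ^{n×n})^{⊗3}), homogeneous of degree m²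
(row c = 2 of E), is NON-ZERO at a tensor of rank ≤ n^{2+δ} (indeed ≤ k^{2t+3} = n^{2+3/t}, a tensor
supported on k³ slices): I(σ_m)_{m²} ⊄ I(σ_{⌊n^{2+δ}⌋}). Proof: Kumar–Volk counting [KumarVolk2022
Thm 10 = tree ObstructionDescentCountingEquations.exists_mem_RV_ne_zero_of_choose_lt] run in the
SUB-format ℂ^{k³}⊗ℂ^{n²}⊗ℂ^{n²} (room (3m²+1)^{m(k³+2n²)} < C(k³n⁴, m²) ⟸ k > 12t+9, via k^D ≤ C(Dk,
D)), re-indexing along the slice inclusion k³ ↪ n² (restriction does not raise rank [Blaser2013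
Lemma 5.4 = tree tensorRank_precomp_le], rename is injective and keeps homogeneity), and
zero-extension of a point where the sub- -/
@[route_item "route-MatrixMultiplication-ObstructionDescent"]
def OvershootFailsRowTwo : Prop :=
  ∀ δ : ℝ, 0 < δ → ∃ τ : ℝ, 2 < τ ∧ ∀ n₀ : ℕ, ∃ n m : ℕ, n₀ ≤ n ∧ n * n ≤ m ∧ (n : ℝ) ^ τ ≤ (m : ℝ) ∧ ∃ f : MvPolynomial ((Fin n × Fin n) × (Fin n × Fin n) × (Fin n × Fin n)) ℂ, f.IsHomogeneous (m ^ 2) ∧ (∀ t : (Fin n × Fin n) → (Fin n × Fin n) → (Fin n × Fin n) → ℂ, Literature.Computability.AlgebraicComplexity.tensorRank t ≤ m → MvPolynomial.aeval (fun p : (Fin n × Fin n) × (Fin n × Fin n) × (Fin n × Fin n) => t p.1 p.2.1 p.2.2) f = 0) ∧ ∃ t : (Fin n × Fin n) → (Fin n × Fin n) → (Fin n × Fin n) → ℂ, (Literature.Computability.AlgebraicComplexity.tensorRank t : ℝ) ≤ (n : ℝ) ^ (2 + δ) ∧ MvPolynomial.aeval (fun p : (Fin n × Fin n) × (Fin n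 × Fin n) × (Fin n × Fin n) => t p.1 p.2.1 p.2.2) f ≠ 0

/-- item stmt-MatrixMultiplication-28215 · aside · rank 9 · open · by planner
why it might fail: G2′ (boundary Kronecker triples with g>0 = flattenings + three hooks) is a ten-case induction cross-checked by census only to d ≤ 19 (all lengths) / d ≤ 29 (≤12 parts); an exotic boundary triple of lengths ≤ N at larger d would put a module in I_d(σ_{d−1}) past the bound [BurgisserIkenmeyer2013 §4].
sources: LandsbergManivel2004, BurgisserIkenmeyer2013, HauensteinIkenmeyerLandsberg2013, LandsbergGCT2017
[aside · UNDECIDED in Lean, TRUE ON PAPER (NODE-g23 §8 Theorems A′ + G2′; exact census N ≤ 12) ·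
DEGREE axis beneath E (30889), MM-free; sharpens the CLOSED aside GapOneEquationsVanish (27778,
hypothesis 3N ≤ d+2) to the exact threshold · banked context, never staffed · typed gen 23
(Sketch24), filed gen 24 on the critic's SHARPEN s1] SHARP GAP-ONE THRESHOLD d₀(N) = ⌈(3N+1)/2⌉: for
N ≥ 2 and 2d ≥ 3N+1, a degree-d form on ℂ^N⊗ℂ^N⊗ℂ^N vanishing on every tensor of rank < d is zero,
i.e. I_d(σ_{d−1}(P^{N−1}×P^{N−1}×P^{N−1})) = 0. Paper proof: (A′) polarisation + the
joint-eigenspace identity (c_λ+c_μ+c_ν + C(d,2))·‖w‖² = 4Σ_τ‖P_τ w‖² identify I_d(σ_{d−1}) with the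
multiplicity space of the triples (λ,μ,ν) ⊢ d of lengths ≤ N with content sum −C(d,2) and g_{λμν} >
0 [LandsbergManivel2004 Lemma 3.1/Cor 3.4 for the polarisation]; (G2′) such boundary triples are
exactly the flattening triples {1^d, μ, μᵀ} and the hook triples {η_a, η_b, η_c}, a+b+c = 2(d−1)
[BurgisserIkenmeyer2013 §4.4 designs give the hook modules], each needing a partition of length > N
once 2d ≥ 3N+1. With GapPropagation (27779, closed) the proved-empty window of I(σ_m((ℂ^N)^{⊗3}))
rises from degree ≤ 2m−3N+4 (Lean, Doub -/
@[route_item "route-MatrixMultiplication-ObstructionDescent"]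
def GapOneThreshold32 : Prop :=
  ∀ (N d : ℕ), 2 ≤ N → 3 * N + 1 ≤ 2 * d → ∀ f : MvPolynomial (Fin N × Fin N × Fin N) ℂ, f.IsHomogeneous d → (∀ t : Fin N → Fin N → Fin N → ℂ, Literature.Computability.AlgebraicComplexity.tensorRank t < d → MvPolynomial.aeval (fun p : Fin N × Fin N × Fin N => t p.1 p.2.1 p.2.2) f = 0) → f = 0

/-- item stmt-MatrixMultiplication-28216 · aside · rank 9 · open · by planner
why it might fail: Non-vanishing of a hook-type HWV in I_d(σ_{d−1}) for EVERY admissible (N,d) is printed only for Bürgisser–Ikenmeyer's designs (symmetric hooks, d ≡ 1 mod 3); other d rest on the cell's census g = 1 (d ≤ 29) + Theorem A′ on paper [BurgisserIkenmeyer2013 §4.4].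
sources: BurgisserIkenmeyer2013, BurgisserIkenmeyer2011, LandsbergManivel2004, LandsbergGCT2017
[aside · KNOWN IN PRINT up to typing (Bürgisser–Ikenmeyer obstruction designs: three lines with arms
p, q, r give a non-zero highest-weight vector of hook type (η_{q+r}, η_{p+r}, η_{p+q}) in
I_d(σ_{d−1}), d = p+q+r+1 [BurgisserIkenmeyer2013 §4.4, BurgisserIkenmeyer2011 §5–6]; NODE-g23 §8) ·
DEGREE axis, MM-free; the LOWER-BOUND side matching GapOneThreshold32 (together: d₀(N) = ⌈(3N+1)/2⌉
exactly) · banked context, never staffed · filed gen 24 on the critic's SHARPEN s1] HOOK EQUATIONS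
EXIST RIGHT BELOW THE THRESHOLD: for N ≥ 2, N < d and 2d+1 ≤ 3N there is a NON-ZERO degree-d form on
ℂ^N⊗ℂ^N⊗ℂ^N vanishing on all tensors of rank < d, I_d(σ_{d−1}((ℂ^N)^{⊗3})) ≠ 0, although no
flattening minor of size d exists (d > N): the hook triple (η_a, η_b, η_c), η_x = (d−x, 1^x), a+b+c
= 2(d−1), max(a,b,c) ≤ N−1 is available exactly when 2(d−1) ≤ 3(N−1). For the matrix-multiplication
format N = n² this is the precise form of the Strassen–Bürgisser–Ikenmeyer 3/2 wall for
MINIMAL-degree equations: degree-(r+1) equations of σ_r((ℂ^{n²})^{⊗3}) exist iff 2r ≤ 3n²−3, so they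
certify bR(⟨n,n,n⟩) ≥ 3n²/2 − O(1) and nothing above [BurgisserIkenmeyer2013 p. 8, H_κ with κ =
(n²−1)/2]. A Lean proof = an ex -/
@[route_item "route-MatrixMultiplication-ObstructionDescent"]
def GapOneHooksExist : Prop :=
  ∀ (N d : ℕ), 2 ≤ N → N < d → 2 * d + 1 ≤ 3 * N → ∃ f : MvPolynomial (Fin N × Fin N × Fin N) ℂ, f.IsHomogeneous d ∧ f ≠ 0 ∧ ∀ t : Fin N → Fin N → Fin N → ℂ, Literature.Computability.AlgebraicComplexity.tensorRank t < d → MvPolynomial.aeval (fun p : Fin N × Fin N × Fin N => t p.1 p.2.1 p.2.2) f = 0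

/-- item stmt-MatrixMultiplication-29039 · support · rank 9 · open · by planner
sources: Blaser2013
[support] E2, the rank form of ω(ℂ) = 2 (the ONE equivalence layer; aside, never staffed): for every
τ > 2, R(⟨n,n,n⟩) ≤ n^τ for all large n. Kernel: `rankEventuallyQuadratic_iff :
RankEventuallyQuadratic ↔ MatrixMultiplication`. [difficulty: provable-now] -/
@[route_item "route-MatrixMultiplication-ObstructionDescent", crux]
def RankEventuallyQuadratic : Prop :=
  ∀ τ : ℝ, 2 < τ → ∃ n₀ : ℕ, ∀ n : ℕ, n₀ ≤ n → (Literature.Computability.AlgebraicComplexity.tensorRank (Literature.Computability.AlgebraicComplexity.matMulTensor ℂ n n n) : ℝ) ≤ (n : ℝ) ^ τ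

/-- item stmt-MatrixMultiplication-29041 · support · rank 9 · open · by planner
sources: BurgisserIkenmeyer2011, DorflerIkenmeyerPanova2020
[support] P_M «no multiplicity obstruction above the quadratic scale» (aside, intermediate node;
target of L, hypothesis of D): same scale as P_O with occurrence replaced by type-wise domination of
co-multiplicities dim(W ∩ I(GL_m³·⟨m⟩)) ≤ dim(W ∩ I(GL_m³·pad_m⟨n,n,n⟩)). NEC kernel
(`noMultiplicityObstruction_of_summit`); `closes_mult : P_M → D → S`. [difficulty: open-problem] -/
@[route_item "route-MatrixMultiplication-ObstructionDescent", crux]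
def NoMultiplicityObstruction : Prop :=
  ∀ τ : ℝ, 2 < τ → ∃ n₀ : ℕ, ∀ n m : ℕ, n₀ ≤ n → ∀ h : n * n ≤ m, (n : ℝ) ^ τ ≤ (m : ℝ) → ∀ (Λ : Fin 3 → Fin m → ℕ) (d : ℕ) (W : Set (MvPolynomial (Fin m × Fin m × Fin m) ℂ)), W = {f | f.IsHomogeneous d ∧ ∀ A B C : Matrix (Fin m) (Fin m) ℂ, ((∀ i j : Fin m, j < i → A i j = 0) ∧ ∀ i : Fin m, A i i ≠ 0) → ((∀ i j : Fin m, j < i → B i j = 0) ∧ ∀ i : Fin m, B i i ≠ 0) → ((∀ i j : Fin m, j < i → C i j = 0) ∧ ∀ i : Fin m, C i i ≠ 0) → ∀ t : Fin m → Fin m → Fin m → ℂ, MvPolynomial.aeval (fun p : Fin m × Fin m × Fin m => Literature.Computability.AlgebraicComplexity.actTensor A B C t p.1 p.2.1 p.2.2) f = (∏ i, A i i ^ Λ 0 i) * (∏ i, B i i ^ Λ 1 i) * (∏ i, C i i ^ Λ 2 i) * MvPolynomial.aeval (fun p : Fin m × Fin m × Fin m => t p.1 p.2.1 p.2.2) f}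 → Module.finrank ℂ ↥(Submodule.span ℂ (W ∩ {f | ∀ A B C : Matrix (Fin m) (Fin m) ℂ, A.det ≠ 0 → B.det ≠ 0 → C.det ≠ 0 → MvPolynomial.aeval (fun p : Fin m × Fin m × Fin m => Literature.Computability.AlgebraicComplexity.actTensor A B C (Literature.Computability.AlgebraicComplexity.unitTensor ℂ m) p.1 p.2.1 p.2.2) f = 0})) ≤ Module.finrank ℂ ↥(Submodule.span ℂ (W ∩ {f | ∀ A B C : Matrix (Fin m) (Fin m) ℂ, A.det ≠ 0 → B.det ≠ 0 → C.det ≠ 0 → MvPolynomial.aeval (fun p : Fin m × Fin m × Fin m => Literature.Computability.AlgebraicComplexity.actTensor A B C ((fun a b c : Fin m => ∑ r : (Fin n × Fin n) × (Fin n × Fin n) × (Fin n × Fin n), (if Fin.castLE h (finProdFinEquiv r.1) = a ∧ Fin.castLE h (finProdFinEquiv r.2.1) = b ∧ Fin.castLE h (finProdFinEquiv r.2.2) = c then (1 : ℂ) else 0) * Literature.Computability.AlgebraicComplexity.matMulTensor ℂ n n n r.1 r.2.1 r.2.2)) p.1 p.2.1 p.2.2) f = 0}))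

/-- item stmt-MatrixMultiplication-29042 · crux · rank 3 · open · by planner
why it might fail: false iff matrix multiplication vs unit tensors is occurrence-complete but multiplicity-incomplete above n^(2+eps) - the DIP20 phenomenon (multiplicity obstructions strictly stronger) transplanted to this pair; T_O1 at (n,m)=(2,6) is its first finite test.
sources: DorflerIkenmeyerPanova2020, BurgisserIkenmeyer2011, HauensteinIkenmeyerLandsberg2013
[crux] L «occurrence lifts to multiplicity»: NoOccurrenceObstruction → NoMultiplicityObstruction,
i.e. if no occurrence obstruction survives above the quadratic scale then, at the same scale and
type by type, dim(W ∩ I(GL_m³·⟨m⟩)) ≤ dim(W ∩ I(GL_m³·pad_m⟨n,n,n⟩)) (equivalently mult_Λ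
ℂ[closure(GL³ pad)]_d ≤ mult_Λ ℂ[closure(GL³⟨m⟩)]_d). Tag UNDECIDED-with-test (S ⟹ L kernel
`occurrenceLifts_of_summit`; L fails exactly in the world P_O ∧ ¬P_M, which DIP20 Thm 2.3(2)
realises in the Chow/power-sum model); leaf INSTRUMENTABLE (T_O1: at (n,m) = (2,6), where
R̲(⟨2,2,2⟩) = 7, is non-membership witnessed by occurrence, by multiplicity only, or by neither up
to degree 20). [deps: NoOccurrenceObstruction] [difficulty: open-problem] -/
@[route_item "route-MatrixMultiplication-ObstructionDescent", crux]
def OccurrenceLifts : Prop :=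
  NoOccurrenceObstruction → NoMultiplicityObstruction

/-- item stmt-MatrixMultiplication-29043 · crux · rank 4 · SPLIT (gen 1) into NoPolyDegreeObstruction, JointBlindnessDecides + glue MultiplicityDecidesGlue · direct attempts still welcome (low priority) · by planner
why it might fail: DECLARED RESIDUAL. false iff omega > 2 while no multiplicity obstruction detects it (orbit-closure non-containment invisible to graded multiplicities at scale n^(2+eps)) - possible in principle since multiplicity domination does not imply containment of orbit closures in general.
sources: BurgisserIkenmeyer2011, BurgisserIkenmeyerPanova2019, arXiv:2411.03444
[crux] D «multiplicity obstructions decide» (DECLARED RESIDUAL): NoMultiplicityObstruction →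
RankEventuallyQuadratic, i.e. if for every τ > 2, all large n and all m ≥ n^τ the multiplicities of
closure(GL_m³·pad_m⟨n,n,n⟩) are dominated type by type by those of closure(GL_m³·⟨m⟩), then
R(⟨n,n,n⟩) ≤ n^{2+o(1)} — completeness of the representation-theoretic obstructions for this pair of
orbit closures (the GCT credo, Mulmuley–Sohoni / BI11 §1). Tag RESIDUAL · IDEA-NEEDED (S ⟹ D kernel
`multiplicityDecides_of_summit`; D holds in every ¬P_M world). [deps: OccurrenceLifts] [difficulty:
open-problem] -/
@[route_item "route-MatrixMultiplication-ObstructionDescent", crux]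
def MultiplicityDecides : Prop :=
  NoMultiplicityObstruction → RankEventuallyQuadratic

-- parent: MultiplicityDecides · child (gen 1)
/--     item stmt-MatrixMultiplication-30889 · crux · rank 401 · open
    parent: MultiplicityDecides · by planner
    why it might fail: ω>2 might be CERTIFIED at polynomial degree: Kumar–Volk Thm 1.4 gives degree ≤ N⁶ equations of σ_r for r ≤ N²/300, Gałązka–Mańdziuk–Rupniewski / Doležálek–Michałek give explicit equations beyond the cactus wall; such a family non-vanishing on pad_m⟨n,n,n⟩ at m ≥ n^{2+η} kills E.
    sources: LandsbergGCT2017, Buczynski2026, BurgisserIkenmeyer2011, arXiv:2003.12938, arXiv:2007.16203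
[crux · WEAKER · NEC · split child of MultiplicityDecides (gen 8, degree axis)] E = no
polynomial-degree obstruction: for every exponent c, at the quadratic scale (τ>2, n ≥ n₀(c,τ), n² ≤
m, n^τ ≤ m) every polynomial of total degree ≤ m^c vanishing on GL_m³·⟨m⟩ (an equation of σ_m of
polynomial degree) vanishes on GL_m³·pad_m⟨n,n,n⟩ — bounded-degree algebraic certificates cannot
prove ω>2. Kernel (evidence DegreeFiltration_g8.lean, rc 0, 0 sorry): NEC
Gen8.noPolyDegreeObstruction_of_summit; rung R1 (ALL equations of degree ≤ m, uniformly in n) PROVED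
(Gen8.formatDegreeBlind_holds / noPolyDegreeObstruction_row_one); rung R2 (DETERMINANTAL equations
of every degree past the cactus wall m ≥ 6n²−4) PROVED from the tree theorem
Buczynski2026_cactusBarrier_segre_holds (Gen8.rankMethodsBlindPastCactus_of). The degree dial
interpolates E_{≤m} (theorem) … E_{poly} (this item, open) … E_{≤deg σ_m} (≡ S, costume); orthogonal
to the information dial occurrence < multiplicity < HWV of gens 6–7. -/
@[route_item "route-MatrixMultiplication-ObstructionDescent", crux]
def NoPolyDegreeObstruction : Prop :=
  ∀ c : ℕ, ∀ τ : ℝ, 2 < τ → ∃ n₀ : ℕ, ∀ n m : ℕ, n₀ ≤ n → ∀ h : n * n ≤ m, (n : ℝ) ^ τ ≤ (m : ℝ) → ∀ f : MvPolynomial (Fin m × Fin m × Fin m) ℂ, f.totalDegree ≤ m ^ c → (∀ A B C : Matrix (Fin m) (Fin m) ℂ, A.det ≠ 0 → B.det ≠ 0 → C.det ≠ 0 → MvPolynomial.aeval (fun p : Fin m × Fin m × Fin m => Literature.Computability.AlgebraicComplexity.actTensor A B C (Literature.Computability.AlgebraicComplexity.unitTensor ℂ m) p.1 p.2.1 p.2.2)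 f = 0) → ∀ A B C : Matrix (Fin m) (Fin m) ℂ, A.det ≠ 0 → B.det ≠ 0 → C.det ≠ 0 → MvPolynomial.aeval (fun p : Fin m × Fin m × Fin m => Literature.Computability.AlgebraicComplexity.actTensor A B C ((fun a b c : Fin m => ∑ r : (Fin n × Fin n) × (Fin n × Fin n) × (Fin n × Fin n), (if Fin.castLE h (finProdFinEquiv r.1) = a ∧ Fin.castLE h (finProdFinEquiv r.2.1) = b ∧ Fin.castLE h (finProdFinEquiv r.2.2) = c then (1 : ℂ) else 0) * Literature.Computability.AlgebraicComplexity.matMulTensor ℂ n n n r.1 r.2.1 r.2.2)) p.1 p.2.1 p.2.2) f = 0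

-- parent: MultiplicityDecides · child (gen 1)
/--     item stmt-MatrixMultiplication-30890 · crux · rank 402 · open
    parent: MultiplicityDecides · by planner
    why it might fail: it is the residual: false iff ω>2 is detectable only by super-polynomial-degree, multiplicity-invisible equations — the regime no known method (occurrence/multiplicity GCT, rank methods below the cactus wall, border apolarity) reaches; no independent evidence.
    sources: BurgisserIkenmeyer2011, BurgisserIkenmeyer2013, LandsbergGCT2017
[crux · DECLARED (joint) RESIDUAL · split child of MultiplicityDecides (gen 8)] B =
(NoMultiplicityObstruction ∧ NoPolyDegreeObstruction) → RankEventuallyQuadratic: the two coarsenings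
of the complete obstruction theory (HWV containment ≡ border-rank S, a costume) — by INFORMATION
(multiplicities, gens 6–7) and by DEGREE (poly-degree equations, gen 8) — JOINTLY decide ω=2.
Strictly below the gen-6 residual D (D ⟹ B, Gen8.jointBlindnessDecides_of_multiplicityDecides) and
below the pure degree residual (E→REQ ⟹ B); NEC (Gen8.jointBlindnessDecides_of_summit); exactness S
⟺ P_O ∧ L ∧ E ∧ B (Gen8.summit_iff₄). Its unique false world: ω>2 with ⟨n,n,n⟩ invisible to
multiplicities AND to every poly-degree equation at every quadratic scale. Honest residual, not
attackable by current tools; kill/prove path = aside PolyDegreeTestBoundsAsymptoticRank (A ∧ E ⟹ S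
in the kernel). -/
@[route_item "route-MatrixMultiplication-ObstructionDescent"]
def JointBlindnessDecides : Prop :=
  NoMultiplicityObstruction ∧ NoPolyDegreeObstruction → RankEventuallyQuadratic

-- parent: MultiplicityDecides · glue (gen 1)
/--     item stmt-MatrixMultiplication-30891 · support · rank 403 · closed · proved by Summit.MatrixMultiplication.MatrixMultiplication.Theorems.ObstructionDescentDegreeSplit.multiplicityDecidesGlue_holds (planner)
    parent: MultiplicityDecides · GLUE: children ⟹ parent · by planner
multiplicityDecides_of_split : NoPolyDegreeObstruction → JointBlindnessDecides → MultiplicityDecides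
:= fun e b pm => b ⟨pm, e⟩ (kernel-checked, decomp-mm-lens-3 gen 8, DegreeFiltration_g8.lean rc 0 /
0 sorry) -/
@[route_item "route-MatrixMultiplication-ObstructionDescent"]
def MultiplicityDecidesGlue : Prop :=
  NoPolyDegreeObstruction → JointBlindnessDecides → MultiplicityDecides

-- `MultiplicityDecidesGlue` holds: proved by `Summit.MatrixMultiplication.MatrixMultiplication.Theorems.ObstructionDescentDegreeSplit.multiplicityDecidesGlue_holds` (its module imports this route file, so no `_holds` link can be stated here).

/-- item stmt-MatrixMultiplication-30920 · aside · rank 9 · closed · proved by Summit.MatrixMultiplication.MatrixMultiplication.Theorems.ObstructionDescentFormatDegreeBlind.formatDegreeBlind_holds (prover) · by planner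
why it might fail: none — proved in the kernel (0 sorry); filed so the proof lands against a named rung
sources: LandsbergGCT2017, BurgisserIkenmeyer2011
[aside · rung R1 of NoPolyDegreeObstruction · PROVED in the kernel (Gen8.formatDegreeBlind_holds,
DegreeFiltration_g8.lean) · provable-now landing target (named-rung rule)] a polynomial of total
degree ≤ m vanishing on GL_m³·⟨m⟩ is the zero polynomial (each monomial involves ≤ m coordinates; a
tensor supported on ≤ m coordinates has rank ≤ m; GL_m³·⟨m⟩ is Zariski dense in rank ≤ m) — MM-free;
yields the c=1 row of E uniformly in n (Gen8.noPolyDegreeObstruction_row_one). -/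
@[route_item "route-MatrixMultiplication-ObstructionDescent"]
def FormatDegreeBlind : Prop :=
  ∀ (m : ℕ) (f : MvPolynomial (Fin m × Fin m × Fin m) ℂ), f.totalDegree ≤ m → (∀ A B C : Matrix (Fin m) (Fin m) ℂ, A.det ≠ 0 → B.det ≠ 0 → C.det ≠ 0 → MvPolynomial.aeval (fun p : Fin m × Fin m × Fin m => Literature.Computability.AlgebraicComplexity.actTensor A B C (Literature.Computability.AlgebraicComplexity.unitTensor ℂ m) p.1 p.2.1 p.2.2) f = 0) → f = 0

-- `FormatDegreeBlind` holds: proved by `Summit.MatrixMultiplication.MatrixMultiplication.Theorems.ObstructionDescentFormatDegreeBlind.formatDegreeBlind_holds` (its module imports this route file, so no `_holds` link can be stated here).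

/-- item stmt-MatrixMultiplication-30921 · aside · rank 9 · closed · proved by Summit.MatrixMultiplication.MatrixMultiplication.Theorems.ObstructionDescentRankMethodsBlind.rankMethodsBlindPastCactus_holds (planner) · by planner
why it might fail: none — corollary of the tree theorem Buczynski2026_cactusBarrier_segre_holds (restrict L along the corner action t ↦ (A,B,C)·pad(t), again a linear rank method on (ℂ^{n²})^⊗3 where K_{6n²−4} fills)
sources: Buczynski2026, LandsbergGCT2017, EfremenkoGargOliveiraWigderson2018
[aside · rung R2 of NoPolyDegreeObstruction (the determinantal class, every degree) · PROVED in the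
kernel modulo the tree THEOREM Buczynski2026_cactusBarrier_segre_holds
(Gen8.rankMethodsBlindPastCactus_of hcb; landing = that term with hcb :=
Buczynski2026_cactusBarrier_segre_holds, import LinearRankMethodBarrierProofs)] past the cactus wall
m ≥ 6n²−4, every linear rank method L : ℂ^{m³} → Mat_{p×q} with rk ≤ k on rank-one tensors has rk
L(g·pad_m⟨n,n,n⟩) ≤ k·m for ALL g ∈ Mat_m³ — the maximum it takes on σ_m — so none of its
σ_m-equations ((km+1)-minors, any degree) separates the pad: the refutation-side barrier
LinearRankMethodBarrier becomes an S-side rung of E. -/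
@[route_item "route-MatrixMultiplication-ObstructionDescent"]
def RankMethodsBlindPastCactus : Prop :=
  ∀ (n m : ℕ) (h : n * n ≤ m), 6 * n ^ 2 - 4 ≤ m → ∀ (p q k : ℕ) (L : (Fin m → Fin m → Fin m → ℂ) →ₗ[ℂ] Matrix (Fin p) (Fin q) ℂ), (∀ w u v : Fin m → ℂ, (L (Literature.Computability.AlgebraicComplexity.triad w u v)).rank ≤ k) → ∀ A B C : Matrix (Fin m) (Fin m) ℂ, (L (Literature.Computability.AlgebraicComplexity.actTensor A B C ((fun a b c : Fin m => ∑ r : (Fin n × Fin n) × (Fin n × Fin n) × (Fin n × Fin n), (if Fin.castLE h (finProdFinEquiv r.1) = a ∧ Fin.castLE h (finProdFinEquiv r.2.1) = b ∧ Fin.castLE h (finProdFinEquiv r.2.2) = c then (1 : ℂ) else 0) * Literature.Computability.AlgebraicComplexity.matMulTensor ℂ n n n r.1 r.2.1 r.2.2)))).rank ≤ k * m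

-- `RankMethodsBlindPastCactus` holds: proved by `Summit.MatrixMultiplication.MatrixMultiplication.Theorems.ObstructionDescentRankMethodsBlind.rankMethodsBlindPastCactus_holds` (its module imports this route file, so no `_holds` link can be stated here).

/-- item stmt-MatrixMultiplication-30922 · aside · rank 9 · open · by planner
why it might fail: a tensor family passing all degree-≤m^c equations of σ_m with R̃ ≥ m^{1+δ₀} (it would refute the asymptotic rank conjecture constructively); cactus-type points pass every determinantal test and their asymptotic rank is unknown
sources: BurgisserClausenShokrollahi1997, ConnerGesmundoLandsbergVenturaWang2020, LandsbergGCT2017, Buczynski2026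
[aside · LAW above the residual JointBlindnessDecides · UNDECIDED · MM-free · banked context, never
staffed] ∃c ∀δ>0, eventually in m: a tensor t ∈ ℂ^m⊗ℂ^m⊗ℂ^m annihilated by every equation of σ_m of
degree ≤ m^c has asymptotic rank R̃(t) ≤ m^{1+δ} («polynomial-degree membership tests already
control asymptotic rank»). Kernel: the asymptotic rank conjecture BCS1997_problem155_negative ℂ ⟹ A
(Gen8.polyDegreeTestBoundsAsymptoticRank_of_arc); A → NoPolyDegreeObstruction → S
(Gen8.summit_of_polyDegreeTest: R̃(⟨n,n,n⟩) ≤ R̃(pad) by restriction, ω = log_n R̃(⟨n,n,n⟩) by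
advxxz2025), hence A ⟹ JointBlindnessDecides. A near-secant WEAKENING of the asymptotic rank
conjecture that still suffices, with E, for ω = 2. -/
@[route_item "route-MatrixMultiplication-ObstructionDescent"]
def PolyDegreeTestBoundsAsymptoticRank : Prop :=
  ∃ c : ℕ, ∀ δ : ℝ, 0 < δ → ∃ m₀ : ℕ, ∀ m : ℕ, m₀ ≤ m → ∀ t : Fin m → Fin m → Fin m → ℂ, (∀ f : MvPolynomial (Fin m × Fin m × Fin m) ℂ, f.totalDegree ≤ m ^ c → (∀ A B C : Matrix (Fin m) (Fin m) ℂ, A.det ≠ 0 → B.det ≠ 0 → C.det ≠ 0 → MvPolynomial.aeval (fun p : Fin m × Fin m × Fin m => Literature.Computability.AlgebraicComplexity.actTensor A B C (Literature.Computability.AlgebraicComplexity.unitTensor ℂ m) p.1 p.2.1 p.2.2) f = 0) → MvPolynomial.aeval (fun p : Fin m × Fin m × Fin m => t p.1 p.2.1 p.2.2) f = 0) → Literature.Computability.AlgebraicComplexity.asymptoticRank t ≤ (m : ℝ) ^ (1 + δ)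

/-- item stmt-MatrixMultiplication-31756 · aside · rank 9 · closed · proved by Summit.MatrixMultiplication.MatrixMultiplication.Theses.ObstructionDescent.isobaricCornerEquationsSuffice_holds (prover) · by planner
why it might fail: none — an equivalence proved in the kernel (0 sorry); filed so the normal form of the degree axis is on the ledger and lands against a named decl
sources: LandsbergGCT2017, BurgisserIkenmeyer2011, Blaser2013
[aside · PROVED in the kernel, gen 9 (Gen9.isobaricCornerEquationsSuffice_text =
Gen9.noPolyDegreeObstruction_iff_cornerBlindnessIsobaric, EquationNormalForm_g9_tree.lean, 0 sorry,
std axioms) · provable-now landing target · banked context beneath E, not a cut piece] ISOBARIC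
NORMAL FORM of a polynomial-degree obstruction: E = NoPolyDegreeObstruction holds iff its corner
form holds for TORUS-WEIGHT VECTORS only — at the quadratic scale (n·n ≤ m, n^τ ≤ m, n ≥ n₀) every
ISOBARIC equation h of σ_m((ℂ^{n×n})^{⊗3}) (all monomials of h have the same weight under the
maximal torus T ⊂ GL_{n²}^{×3}, i.e. the same three marginals) of degree ≤ m^c vanishes at the FIXED
tensor ⟨n,n,n⟩. Mechanism (kernel, any format ℂ^α⊗ℂ^β⊗ℂ^γ): {R ≤ m} is T-stable, so isobaric
components of equations of σ_m are equations (torus-weight law); together with the support law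
(every monomial of an equation of σ_m uses ≥ m+1 distinct cells) and the table formula (h(⟨n,n,n⟩) =
Σ of the coefficients of the monomials of h supported inside supp⟨n,n,n⟩), the IDEA-NEEDED core of E
becomes: for every isobaric equation, the signed coefficient sum over ONE 2-margin fiber of 3-way
tables e : [n]³ → ℕ (|supp e| ≥ m+1) vanishe -/
@[route_item "route-MatrixMultiplication-ObstructionDescent"]
def IsobaricCornerEquationsSuffice : Prop :=
  NoPolyDegreeObstruction ↔ ∀ c : ℕ, ∀ τ : ℝ, 2 < τ → ∃ n₀ : ℕ, ∀ n m : ℕ, n₀ ≤ n → n * n ≤ m → (n : ℝ) ^ τ ≤ (m : ℝ) → ∀ h : MvPolynomial ((Fin n × Fin n) × (Fin n × Fin n) × (Fin n × Fin n)) ℂ, (∃ w : (Fin n × Fin n) ⊕ (Fin n × Fin n) ⊕ (Fin n × Fin n) →₀ ℕ, ∀ μ ∈ h.support, (μ.sum fun p k => k • (Finsupp.single (Sum.inl p.1) 1 + Finsupp.single (Sum.inr (Sum.inl p.2.1)) 1 + Finsupp.single (Sum.inr (Sum.inr p.2.2)) 1)) = w) → h.totalDegree ≤ m ^ c → (∀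 t : (Fin n × Fin n) → (Fin n × Fin n) → (Fin n × Fin n) → ℂ, Literature.Computability.AlgebraicComplexity.tensorRank t ≤ m → MvPolynomial.aeval (fun p : (Fin n × Fin n) × (Fin n × Fin n) × (Fin n × Fin n) => t p.1 p.2.1 p.2.2) h = 0) → MvPolynomial.aeval (fun p : (Fin n × Fin n) × (Fin n × Fin n) × (Fin n × Fin n) => Literature.Computability.AlgebraicComplexity.matMulTensor ℂ n n n p.1 p.2.1 p.2.2) h = 0

-- `IsobaricCornerEquationsSuffice` holds: proved by `Summit.MatrixMultiplication.MatrixMultiplication.Theses.ObstructionDescent.isobaricCornerEquationsSuffice_holds` (its module imports this route file, so no `_holds` link can be stated here).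

/-- item stmt-MatrixMultiplication-32149 · aside · rank 9 · closed · proved by Summit.MatrixMultiplication.MatrixMultiplication.Theses.ObstructionDescent.unitOrbitIdealPrime_holds (planner) · by planner
why it might fail: none — proved in the kernel (0 sorry); filed so the engine of the information axis is on the ledger and lands against a named decl
sources: BurgisserIkenmeyer2011, BurgisserIkenmeyer2017
[aside · PROVED in the kernel, gen 10 (Gen10.unitOrbitIdealPrime_holds_text =
ObstructionCalculus.mul_mem_orbitVanishing_unitTensor_iff, SemigroupEngine_g10_tree.lean, 0 sorry,
std axioms) · provable-now landing target · banked context beneath P_O] THE SEMIGROUP ENGINE'S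
HEART: for every m the polynomials vanishing on the orbit GL_m³·⟨m⟩ (equivalently on σ_m = {border
rank ≤ m} ⊂ (ℂ^m)^{⊗3}) form a PRIME IDEAL — f·g vanishes there iff f or g does (kernel:
I(GL_m³·⟨m⟩) = ker of the generic substitution x_{abc} ↦ Σ_i A_{ai}B_{bi}C_{ci} into ℂ[A,B,C], a
domain; density of invertible triples). Consequences proved in the same file: weight vectors
multiply (W_{Λ₁,d₁}·W_{Λ₂,d₂} ⊆ W_{Λ₁+Λ₂,d₁+d₂}), so the types OCCURRING in ℂ[σ_m] form a semigroup
(Bürgisser–Ikenmeyer 2011 Lemma 3.2, now kernel), and with the two proved saturation rungs (degree ≤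
m; #parts·#parts ≤ m in two slots) the registered hard stub UnitSaturationCore of the P_O line is
EQUIVALENT to its restriction to K-INDECOMPOSABLE types
(Gen10.unitSaturationCore_iff_indecomposableCore, strong induction on the degree). Negative
knowledge recorded with it (hand, BI17 Thm 5.9): the rectangular tower ((n^{n²}))³ is
K-indecomposable -/
@[route_item "route-MatrixMultiplication-ObstructionDescent"]
def UnitOrbitIdealPrime : Prop :=
  ∀ (m : ℕ) (f g : MvPolynomial (Fin m × Fin m × Fin m) ℂ), (∀ A B C : Matrix (Fin m) (Fin m) ℂ, A.det ≠ 0 → B.det ≠ 0 → C.det ≠ 0 → MvPolynomial.aeval (fun p : Fin m × Fin m × Fin m => Literature.Computability.AlgebraicComplexity.actTensor A B C (Literature.Computability.AlgebraicComplexity.unitTensor ℂ m) p.1 p.2.1 p.2.2) (f * g) = 0) ↔ ((∀ A B C : Matrix (Fin m) (Fin m) ℂ, A.det ≠ 0 → B.det ≠ 0 → C.det ≠ 0 → MvPolynomial.aeval (fun p : Fin m × Fin m × Fin m => Literature.Computability.AlgebraicComplexity.actTensor A B C (Literature.Computability.AlgebraicComplexity.unitTensor ℂ m) p.1 p.2.1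 p.2.2) f = 0) ∨ (∀ A B C : Matrix (Fin m) (Fin m) ℂ, A.det ≠ 0 → B.det ≠ 0 → C.det ≠ 0 → MvPolynomial.aeval (fun p : Fin m × Fin m × Fin m => Literature.Computability.AlgebraicComplexity.actTensor A B C (Literature.Computability.AlgebraicComplexity.unitTensor ℂ m) p.1 p.2.1 p.2.2) g = 0))

-- `UnitOrbitIdealPrime` holds: proved by `Summit.MatrixMultiplication.MatrixMultiplication.Theses.ObstructionDescent.unitOrbitIdealPrime_holds` (its module imports this route file, so no `_holds` link can be stated here).

-- earlier InvariantSaturation (stmt-MatrixMultiplication-32150, replaced 2026-08-30T10:57:05Z -> stmt-MatrixMultiplication-32282): retired by None — ∀ τ : ℝ, 2 < τ → τ < 4 → ∃ n₀ : ℕ, ∀ n m : ℕ, n₀ ≤ n → n * n ≤ m → (n : ℝ) ^ τ ≤ (m : ℝ) → ∀ k : ℕ, m < k * (n * n) → ∀ (W : Set (MvPolynomial (Fin m × Fin m × Fin m) ℂ)), W = {f | f.IsHomogeneous (k * (n * n)) ∧ ∀ A B C : Matrix (Fin m) (Fin m) ℂ, ((∀ 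
/-- item stmt-MatrixMultiplication-32282 · aside · rank 9 · open · by planner
why it might fail: odd levels: every SL_{n²}³-invariant of odd level k vanishes at ⟨n²⟩ (sgn^k) and the toy level (N,k) = (4,3) vanishes on all of σ_5 — r_N(k) may grow faster than N^{1+o(1)} for odd k (no non-vanishing point of F_n, n odd, of sub-generic rank is known: LiZhangXia2021 Problem 4.3)
sources: BurgisserIkenmeyer2017, BurgisserIkenmeyer2011, LiZhangXia2021
[aside · UNDECIDED-with-test (census T_O3-b) · NECESSARY for the registered hard stub
UnitSaturationCore of the P_O line (PROVED in kernel: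
Gen10.invariantSaturationText_of_unitSaturationCore + tree bridge
invariantSaturation_of_unitSaturationCore, SemigroupEngine_g10_tree.lean, 0 sorry) · banked context
beneath P_O, not a cut piece · RESTATED rev 6 (gen 10): rev-5 text put the weight k on the FIRST n²
coordinates; in the kernel's convention (borel = upper-triangular, substitution action) non-zero
weight vectors have NON-DECREASING exponent rows (𝔰𝔩₂ lowering), so that label carries no weight
vectors for n² < m and the rev-5 item was VACUOUSLY TRUE; the live label is RIGHT-aligned (k on the
LAST n² coordinates; kernel anchor X_last_pow_mem_hwvSpace_rectType_one), which this text uses —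
same words, same mathematics] THE INVARIANT TOWER: for 2 < τ < 4, all large n, n² ≤ m, n^τ ≤ m and
every k with k·n² > m: if every weight vector of the rectangular type ((k^{n²}))³ (on the last n²
coordinates of each slot, zeros before) in degree k·n² — i.e. every SL_{n²}³-INVARIANT of degree
k·n² of (ℂ^{n²})^{⊗3}, pulled back along the coordinate projections ℂ^m → ℂ^{n²} — vanishes on
GL_m³·⟨m⟩, the -/
@[route_item "route-MatrixMultiplication-ObstructionDescent"]
def InvariantSaturation : Prop :=
  ∀ τ : ℝ, 2 < τ → τ < 4 → ∃ n₀ : ℕ, ∀ n m : ℕ, n₀ ≤ n → n * n ≤ m → (n : ℝ) ^ τ ≤ (m : ℝ) → ∀ k : ℕ, m < k * (n * n) → ∀ (W : Set (MvPolynomial (Fin m × Fin m × Fin m) ℂ)), W = {f | f.IsHomogeneous (k * (n * n)) ∧ ∀ A B C : Matrix (Fin m) (Fin m) ℂ, ((∀ i j : Fin m, j < i → A i j = 0) ∧ ∀ i : Fin m, A i i ≠ 0) → ((∀ i j : Fin m, j < i → B i j = 0) ∧ ∀ i : Fin m, B i i ≠ 0) → ((∀ i j : Fin m, j < i → C i j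 = 0) ∧ ∀ i : Fin m, C i i ≠ 0) → ∀ t : Fin m → Fin m → Fin m → ℂ, MvPolynomial.aeval (fun p : Fin m × Fin m × Fin m => Literature.Computability.AlgebraicComplexity.actTensor A B C t p.1 p.2.1 p.2.2) f = (∏ i, A i i ^ (if m ≤ (i : ℕ) + n * n then k else 0)) * (∏ i, B i i ^ (if m ≤ (i : ℕ) + n * n then k else 0)) * (∏ i, C i i ^ (if m ≤ (i : ℕ) + n * n then k else 0)) * MvPolynomial.aeval (fun p : Fin m × Fin m × Fin m => t p.1 p.2.1 p.2.2) f} → (∀ f ∈ W, ∀ A B C : Matrix (Fin m) (Fin m) ℂ, A.det ≠ 0 → B.det ≠ 0 → C.det ≠ 0 → MvPolynomial.aeval (fun p : Fin m × Fin m × Fin m => Literature.Computability.AlgebraicComplexity.actTensor A B C (Literature.Computability.AlgebraicComplexity.unitTensor ℂ m) p.1 p.2.1 p.2.2) f = 0) → ∀ f ∈ W, f = 0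

/-- item stmt-MatrixMultiplication-33327 · aside · rank 9 · open · by planner
why it might fail: verified lifts are two toy cases ((2,2)→4, (3,1)→4) and propagated parity already KILLS the naive odd-level chains ((4,1)→5, (4,4)→8, (4,4,1)→9 carry no level-3 vector); c = 2 is open at N = 9 (r_9(3) ≤ 18 = census T15); a family of rectangular invariants vanishing on σ_{cN} for every c refutes it
sources: BurgisserIkenmeyer2017, BurgisserIkenmeyer2011, LandsbergGCT2017, AmanovYeliussizov2022
[aside · UNDECIDED-with-test · STRONGER than the aside InvariantSaturation (32282) — kernel theorem
invariantSaturation_of_blockLinearSaturation : BlockLinearSaturation → InvariantSaturation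
(Sketch_H10.lean rc 0, 0 sorry; landing file ObstructionDescentBlockReduction.lean) · banked context
beneath P_O, not a cut piece · gen 11 (decomp-mm-lens-3), mechanism H10] LINEAR-SCALE SATURATION OF
THE INVARIANT TOWER: ∃ c such that for every corner format N ≥ 1 and every m ≥ c·N, EVERY level k of
the tower (weight vectors of the right-aligned rectangular type ((0^{m−N},k^N))³ in degree kN of
format m = the degree-kN SL_N³-invariants R_k(N) of (ℂ^N)^{⊗3} pulled back to the corner) is empty
or has a member not vanishing on GL_m³·⟨m⟩ (= on σ_m). Conjectured c = 2 (N ≤ 5 hold: m*(4) = 6,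
σ_10(5³) = all; N = 9 needs r_9(3), r_9(5), r_9(7) ≤ 18 — census T15 tests r_9(3) ≤ 18). It says
m*(n) = O(n²), whence τ*(n) → 2. MECHANISM H10 = THE LEVI-RESTRICTION CALCULUS (new in this
programme; NODE-g11 §1): (a) RESTRICTION LAW [hand-proved: block-diagonal Borel + block torus]: for
a block point w₁ ⊕ … ⊕ w_r of the corner (sizes N₁+…+N_r = N) every level-k vector F satisfies
F(w₁⊕…⊕w_r) = (Res F)(w₁,…,w_r -/
@[route_item "route-MatrixMultiplication-ObstructionDescent", crux]
def BlockLinearSaturation : Prop :=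
  ∃ c : ℕ, ∀ N m : ℕ, 1 ≤ N → c * N ≤ m → ∀ k : ℕ, ∀ (W : Set (MvPolynomial (Fin m × Fin m × Fin m) ℂ)), W = {f | f.IsHomogeneous (k * N) ∧ ∀ A B C : Matrix (Fin m) (Fin m) ℂ, ((∀ i j : Fin m, j < i → A i j = 0) ∧ ∀ i : Fin m, A i i ≠ 0) → ((∀ i j : Fin m, j < i → B i j = 0) ∧ ∀ i : Fin m, B i i ≠ 0) → ((∀ i j : Fin m, j < i → C i j = 0) ∧ ∀ i : Fin m, C i i ≠ 0) → ∀ t : Fin m → Fin m → Fin m → ℂ, MvPolynomial.aeval (fun p : Fin m × Fin m × Fin m => Literature.Computability.AlgebraicComplexity.actTensor A B C t p.1 p.2.1 p.2.2) f = (∏ i, A i i ^ (if m ≤ (i : ℕ) + N then k else 0)) * (∏ i, B i i ^ (if m ≤ (i : ℕ) + N then k else 0)) * (∏ i, C i i ^ (if m ≤ (i : ℕ) + N then k else 0)) * MvPolynomial.aeval (fun p : Fin m × Fin m × Fin m => t p.1 p.2.1 p.2.2) f} → (∀ f ∈ W, ∀ A B C : Matrix (Fin m) (Fin m) ℂ,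 A.det ≠ 0 → B.det ≠ 0 → C.det ≠ 0 → MvPolynomial.aeval (fun p : Fin m × Fin m × Fin m => Literature.Computability.AlgebraicComplexity.actTensor A B C (Literature.Computability.AlgebraicComplexity.unitTensor ℂ m) p.1 p.2.1 p.2.2) f = 0) → ∀ f ∈ W, f = 0

/-- item stmt-MatrixMultiplication-29044 · assembly · rank 1 · open · by planner
sources: BurgisserIkenmeyer2011, Blaser2013
[assembly] NoOccurrenceObstruction → OccurrenceLifts → MultiplicityDecides → ω(ℂ) = 2. -/
@[route_item "route-MatrixMultiplication-ObstructionDescent"]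
def Assembly : Prop :=
  NoOccurrenceObstruction → OccurrenceLifts → MultiplicityDecides → _root_.MatrixMultiplication

/-! D-0027 §2.1 — DECIDING THEOREM (planner-authored via `route open/edit --closes-file`; by planner-decomp-mm-lens-3-g6-0 2026-08-30T06:06:11Z):
its hypotheses are this route's items and its conclusion the sub-problem Statement (glue_lint), and it elaborates with this file. -/

@[closes "route-MatrixMultiplication-ObstructionDescent"] theorem closes (h₁ : NoOccurrenceObstruction) (h₂ : OccurrenceLifts) (h₃ : MultiplicityDecides) :
    _root_.MatrixMultiplication := by
  have h : RankEventuallyQuadratic := h₃ (h₂ h₁)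
  refine MatrixMultiplication_iff.2 (le_antisymm ?_
    (Literature.Computability.AlgebraicComplexity.omega_two_le ℂ))
  refine le_of_forall_pos_le_add fun ε hε => ?_
  obtain ⟨n₀, hn₀⟩ := h (2 + ε) (by linarith)
  refine csInf_le (Literature.Computability.AlgebraicComplexity.admissibleExponents_bddBelow ℂ) ?_
  refine Asymptotics.IsBigO.of_bound 1 ?_
  filter_upwards [Filter.eventually_ge_atTop n₀] with n hn
  rw [one_mul, Real.norm_of_nonneg (Nat.cast_nonneg _),
    Real.norm_of_nonneg (Real.rpow_nonneg (Nat.cast_nonneg _) _)]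
  exact hn₀ n hn

end Summit.MatrixMultiplication.MatrixMultiplication.Theses.ObstructionDescent
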